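import Literature.MathematicalPhysics.QuantumFieldTheory.Balaban1983to89.B9SectBL2ReadingsY
import Literature.MathematicalPhysics.QuantumFieldTheory.Balaban1983to89.B9SectBCodedChainGlob
import Literature.MathematicalPhysics.QuantumFieldTheory.Balaban1983to89.B9SectBL2StepAtLettersV2

/-!
# `Balaban1983to89.B9SectBL2DictionaryY` — THE `ℓ²` conj-`b` DICTIONARY (both directions, any `ℝ`-linear letter) and THE AUGMENTED (3.46) READINGS
# `l2AugS` ∕ `KSC₃` of NODE 00's G′ over the coded carrier: all six `L²` members, all sign combinations of the covariant differences, letters at the BASE;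
# the eleven `L²` reading∕writing fields of the Sect.-B frames (`L2Frame₂.readL2 … SectBFrame₄.writeL2_5`) PROVED for `KSC₃`

T. Bałaban, *Propagators for lattice gauge theories in a background field*, Commun. Math. Phys. **99** (1985) 389–434
[`Balaban1985BackgroundPropagators`, "B9"]; [4] = T. Bałaban, *Propagators and renormalization transformations for lattice gauge theories. II*,
Commun. Math. Phys. **96** (1984) 223–250 [`Balaban1984PropagatorsII`].

statement-level skeleton of published theorems with citation tags; proofs where landed; nothing here is a claim about the Yang–Mills mass gap

THE PRINTED LOCI (verbatim).  Theorem 3.1 (3.46) p. 398: *"Finally, we have the inequalities in L²-norms ‖hG′(U)λ‖, ‖h∇_UG′(U)λ‖, … ≤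
B₀[(Lʲη)², Lʲη, Lʲη, 1, 1, 1]|h|e^{−δ₀d(y,y′)}‖λ‖ for supp h ⊂ Δ(y), y ∈ Λ_j, supp λ ⊂ Δ(y′)"*; p. 398, first remark after the theorem: *"At first the
choice of derivatives ∇_U, ∇*_U is conventional, we may always replace ∇_U by ∇*_U, and vice versa, in arbitrary place and combination"*; p. 403
l. 1–9: *"… we can prove all the statements (3.42)–(3.47) of Theorem 3.1 for the operator G′(U′U), of course with different constants"*; [4] Prop. 2.6
(2.140) p. 247 (*"‖ζTJ‖ ≤ K(y,y′)‖J‖ if supp ζ ⊂ Δ(y), supp J ⊂ Δ(y′)"*), (2.51)–(2.52) p. 232 (block majorants and their composition).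

WHY THIS FILE (pub-ymgap N06 row 13, seat dag-n06-c gen 9; the (O4) ARCHITECTURE located by gen 8, HOME `HANDOFF.md`).  The Sect.-B frames over the
coded carrier are inhabited member by member by AUGMENTED readings whose reading∕writing fields are TAUTOLOGICAL (threshold-free), the conversion to
the record's member being paid in the transfer (`hin` at bases, `hout` at products).  Gen 7∕8 did this for (3.42) (`KSC`), (3.47) (`KSC₂`) and
analyticity; gen 8's `B9SectBL2ReadingsY` read entry 0 of (3.46).  THIS FILE does the whole `L²` member:
* §0 ★ THE GENERIC `ℓ²` conj-`b` DICTIONARY for an arbitrary `ℝ`-linear letter `T` of `𝔸`-valued site functions (constant `c_L = √|ι|·M₂·Σ_j‖b_j‖` both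
  ways): `hasL2Majorant_conj_of_indBound` (block-`ℓ²` bounds of `T` on product-form inputs `f ⊗ E` with the indicator cut-off ⇒ `HasL2Majorant` of
  `conj b T`, [4] (2.140) through coordinates) and `l2OfY_liftY_le_of_hasL2Majorant_conj` (the converse, any cut-off `h`: `‖h·T(f ⊗ E)‖ ≦
  c_L·K(y,y′)·|h|·‖f‖`).
* §1 THE SIX `L²` WORDS: on the `𝔸` side `wordS O U₀ V n k l` (`OΛ, ∇♯_kOΛ, O∇♯_kΛ, ∇♯_k∇♯_lOΛ, ∇♯_kO∇♯_lΛ, O∇♯_k∇♯_lΛ` — differences `dirS U₀ k`,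
  `k ∈ κ ⊕ κ`: forward `∇_{U₀,μ}` AND backward `∇*_{U₀,μ}`, as print's remark allows and the frames' letters `∇♯_k` require; operator at `V`) and on the
  frame side `wordL O U₀ V η n k l` (the frames' composites of `conj`-letters `diffLetter … k` and `η²·O(V)`), with ★ `norm_wordL_apply`
  (`‖(wordL …)Λ(z)‖ = η^{(2,1,1,0,0,0)_n}·‖(wordS …)Λ(z)‖`).
* §2 THE AUGMENTED `L²` READING `l2AugS i cfg O` over any backgrounds record decoding to coded configurations: member `n` = `η^{e_n}·sup_E sup_{k,l}
  ‖h·wordS_n(f ⊗ E)‖₂` (letters at the BASE `baseY (cfg c)`, operator at the decoding `decY (cfg c)`), and ★★ its two-way dictionary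
  `hasL2Majorant_wordL_of_l2AugS` ∕ `l2AugS_le_of_hasL2Majorant_wordL` (per member, tautological up to §0).
* §3 `KSC₃ := KSC₂` with `l2 := l2AugS` at the record; member lemmas; the root∕(3.47) dictionaries inherited (`read342Y_KSC₃`, `write342Y_KSC₃`,
  `globBlock_KSC₃_prod`); ★★ the ELEVEN `L²` FIELDS OF THE FRAMES AT `KSC₃` in their literal shapes: `readL2_KSC₃` (members 0, 1), `readL2_two ∕ three ∕
  four ∕ five_KSC₃`, `writeL2_zero … writeL2_five_KSC₃` (reading constant `c_L`, writing functions `(c_L·B + 1, δ)`).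
* §4 ★★ `l2Frame₂CodedOn` — THE `L²` FRAME `B9SectBL2StepAtLettersV2.L2Frame₂` OVER THE CODED CARRIERS OF A SUBFAMILY, INHABITED at `KSC₃` (extends gen 8's
  `gpFrame₂CodedOn`); `globFrame₂CodedOn₃` (the (3.47) frame at `KSC₃`, as for `KSC₂`).

HONEST SCOPE.  Finite-dimensional linear algebra and bookkeeping over NODE 00's DEFINED readings; no estimate of [B9] is proved or asserted (the (3.46)
block is the HYPOTHESIS on the reading side, the majorants on the writing side).  What the augmentation costs is NOT here: the transfer for `KSC₃` —
`hin` (the record's (3.46) block at a base, print's three second-order combinations, ⟹ all combinations: print's remark p. 398 made quantitative) and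
`hout` (the augmented member at a product, letters at `U`, ⟹ the record's member at `W = U′U`, letters at `W`) — is the successor's; until then the
frames over `KSC₃` are inhabited but not yet chained to the record (the chain of `B9SectBCodedChainGlob` is for `KSC₂`).  Per-member section `ιB` of `β`
(`hι`, corner-free members).  COUNT-NEUTRAL; N06 NOT discharged; one finite lattice programme — nothing continuum ∕ OS ∕ mass-gap ∕ Clay.  Cell `pub-ymgap`
(HUMAN RULING D-0062), Track A node N06 [B9], row 13, 2026-08-28.

RELATED IN THE TREE, NOT DUPLICATED (used by name): `B9SectBL2ReadingsY` (`indY`, `cutIn_indY`, `supF_indY_le_one`, `l2OfY_eq_l2n`, `l2OfY_smul`,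
`l2OfY_sum_le`, `l2Norm_col_le`, `l2n_blockPiece_conj_le`), `B9SectBGpReadingsY` (`baseY`, `KSC`, `coordEquiv_symm_eq_sum_liftY`, `liftY_eq_liftY_unit`,
`exists_ball_bound`, `len_label`, `dist_label`, `off_of_suppIn_inl`, `read342Y_KSC`, `write342Y_KSC`), `B9SectBCodedChainGlob` (`KSC₂`), `B9SectBGpLettersY`
(`decY`, `GopC`, `coordC`, `letters_base_of_gVal`), `B9Eq352DivFormLetters` (`conj`, `coordEquiv`), `B9Eq352GradLetters` (`diffLetter`), `B6RandomWalkL2`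
(`HasL2Majorant`, `l2n`, `blockPiece`), `B9Thm314WholeExpansionReads` (`le_iSup_ball_iSup`), `B9SectBCodedChainOnSubfamily` (`gpFrame₂CodedOn`).
-/

noncomputable section

namespace Literature.MathematicalPhysics.QuantumFieldTheory.Balaban1983to89.B9SectBL2DictionaryY

open Literature.MathematicalPhysics.QuantumFieldTheory.Balaban1983to89
open Literature.MathematicalPhysics.QuantumFieldTheory.Balaban1983to89.B6KLevelCensusIndexV1 (KIdx kGeo)
open Literature.MathematicalPhysics.QuantumFieldTheory.Balaban1983to89.B6Ineq2142KLevelV1 (β)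
open Literature.MathematicalPhysics.QuantumFieldTheory.Balaban1983to89.B6RandomWalk (blockPiece)
open Literature.MathematicalPhysics.QuantumFieldTheory.Balaban1983to89.B6RandomWalkL2 (l2n l2n_nonneg l2n_sq l2n_add_le l2n_sum_le l2n_smul l2n_mono HasL2Majorant)
open Literature.MathematicalPhysics.QuantumFieldTheory.Balaban1983to89.B9Thm34Ext (toB6)
open Literature.MathematicalPhysics.QuantumFieldTheory.Balaban1983to89.B9FromB6 (EBlock L2Block GlobBlock pref6_nonneg)
open Literature.MathematicalPhysics.QuantumFieldTheory.Balaban1983to89.B9Eq39Adjoint (fluct)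
open Literature.MathematicalPhysics.QuantumFieldTheory.Balaban1983to89.B9Eq352DivFormLetters (conj conj_apply conj_mul coordEquiv coordEquiv_apply
  coordEquiv_symm_apply)
open Literature.MathematicalPhysics.QuantumFieldTheory.Balaban1983to89.B9Eq352GradLetters (diffLetter)
open Literature.MathematicalPhysics.QuantumFieldTheory.Balaban1983to89.B9SectBCodedCarrier (CCfg)
open Literature.MathematicalPhysics.QuantumFieldTheory.Balaban1983to89.B9Eq360DeltaPrimeAY (AfldY mulY blkY blkY_apply)
open Literature.MathematicalPhysics.QuantumFieldTheory.Balaban1983to89.B9PinMembersKLevelV1 (MemberY geo9Y bg9Y)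
open Literature.MathematicalPhysics.QuantumFieldTheory.Balaban1983to89.B9SectBGpLettersY (decY GVal coordC blkC GopC letters_base_of_gVal)
open Literature.MathematicalPhysics.QuantumFieldTheory.Balaban1983to89.B9SectBGpFrameCodedY (codingYx CplxLettersY Read342Y Write342Y)
open Literature.MathematicalPhysics.QuantumFieldTheory.Balaban1983to89.B9SectBGpReadingsY (baseY KSC exists_ball_bound suppIn_inl_of_blkC etaS_eq_eta
  coordEquiv_symm_eq_sum_liftY liftY_eq_liftY_unit real_smul_fun len_label dist_label off_of_suppIn_inl read342Y_KSC write342Y_KSC)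
open Literature.MathematicalPhysics.QuantumFieldTheory.Balaban1983to89.B9SectBL2ReadingsY (indY indY_nonneg_le_one supF_indY_le_one cutIn_indY
  l2OfY_eq_l2n l2OfY_smul l2OfY_sum_le l2Norm_col_le l2n_blockPiece_conj_le)
open Literature.MathematicalPhysics.QuantumFieldTheory.Balaban1983to89.B9Thm314WholeExpansionReads (le_iSup_ball le_iSup_ball_iSup)
open Literature.MathematicalPhysics.QuantumFieldTheory.Balaban1983to89.B9GeoLemma21KLevelV1 (geo9Y_len_pos geo9K_eta_pos)
open Literature.MathematicalPhysics.QuantumFieldTheory.Balaban1983to89.Node00 (SiteY BlkY IBondY CfgY BallY SiteOpY SiteParY UboxY shiftY cdS cdsS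
  liftY liftY_apply l2OfY etaS kernelFamilyS GpY cdS_add cdS_smul cdsS_add cdsS_smul ballY_nonempty)

variable {𝔸 : Type} [NormedRing 𝔸] [NormedAlgebra ℂ 𝔸] [CompleteSpace 𝔸] [FiniteDimensional ℝ 𝔸]
variable {d ℓ : ℕ} {hd : 1 ≤ d + 1} {hL : Odd (ℓ + 1) ∧ 1 < ℓ + 1} {b₀ b₁ : ℝ} {Mstar : ℕ}

/-! ## §0 ★ The generic `ℓ²` conj-`b` dictionary -/

section Dictionary

variable (x : MemberY d ℓ hd hL b₀ b₁ Mstar) (ιB : BlkY x.toKIdx → IBondY x.toKIdx) {ι : Type} [Fintype ι] (b : Module.Basis ι ℝ 𝔸)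
  [Fintype (geo9Y x).Site] [DecidableEq (geo9Y x).Site]

omit [NormedRing 𝔸] [NormedAlgebra ℂ 𝔸] [CompleteSpace 𝔸] [FiniteDimensional ℝ 𝔸] [Fintype (geo9Y x).Site] [DecidableEq (geo9Y x).Site] in
/-- the reading's `‖λ‖` of a scalar site function is `(Σ_z λ(z)²)^{1/2}`. [cite: Balaban1985BackgroundPropagators, (3.46) p.398 («‖λ‖»), bookkeeping] -/
theorem l2Norm_inl_eq (f : SiteY x.toKIdx → ℝ) : (geo9Y x).l2Norm (.inl f) = Real.sqrt (∑ z, f z ^ 2) := rfl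

omit [NormedRing 𝔸] [NormedAlgebra ℂ 𝔸] [CompleteSpace 𝔸] [FiniteDimensional ℝ 𝔸] [DecidableEq (geo9Y x).Site] in
/-- a scaled coordinate column is `ℓ²`-bounded by the scale times the whole coordinate function. [cite: Balaban1984PropagatorsII, (2.51) p.232, bookkeeping] -/
theorem l2Norm_smul_col_le (u : SiteY x.toKIdx × ι → ℝ) (j : ι) (c : ℝ) :
    (geo9Y x).l2Norm (.inl fun z => c * u (z, j)) ≤ |c| * l2n u := by
  have h := l2Norm_col_le x u j
  rw [l2Norm_inl_eq] at h ⊢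
  have hc : ∑ z, (c * u (z, j)) ^ 2 = c ^ 2 * ∑ z, u (z, j) ^ 2 := by
    rw [Finset.mul_sum]; exact Finset.sum_congr rfl fun z _ => by ring
  rw [hc, Real.sqrt_mul (sq_nonneg c), Real.sqrt_sq_eq_abs]
  exact mul_le_mul_of_nonneg_left h (abs_nonneg c)

omit [CompleteSpace 𝔸] [FiniteDimensional ℝ 𝔸] in
/-- ★ **READING ⇒ `ℓ²` MAJORANT** ([4] (2.140) through coordinates): if the `ℝ`-linear letter `T` satisfies, for every product-form input `f ⊗ E` with
`‖E‖ ≦ 1` and `f` supported in the labelled block `y′`, the block-`ℓ²` bound `‖1_{Δ(y)}·T(f ⊗ E)‖ ≦ K(y,y′)·‖f‖` (`K ≧ 0`), then `conj b T` has the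
block-`ℓ²` majorant `c_L·K`, `c_L = √|ι|·M₂·Σ_j‖b_j‖`.  Route: `coord⁻¹u = Σ_j (‖b_j‖u_j) ⊗ E_j` (`E_j = b_j∕‖b_j‖`).
[cite: Balaban1984PropagatorsII, Prop. 2.6 (2.140) p.247, (2.51)–(2.52) p.232; Balaban1985BackgroundPropagators, (3.39) p.397, (3.46) p.398] -/
theorem hasL2Majorant_conj_of_indBound {M₂ : ℝ} (hM₂ : 0 ≤ M₂) (hrepr : ∀ (v : 𝔸) (j : ι), |b.repr v j| ≤ M₂ * ‖v‖) (R : ℝ) (H : Prop)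
    (T : Module.End ℝ (SiteY x.toKIdx → 𝔸)) (K : IBondY x.toKIdx → IBondY x.toKIdx → ℝ) (hK : ∀ a a', 0 ≤ K a a')
    (hT : ∀ (f : SiteY x.toKIdx → ℝ) (E : 𝔸) (y y' : IBondY x.toKIdx), ‖E‖ ≤ 1 → (∀ z, blkC x.toKIdx ιB z ≠ y' → f z = 0) →
      l2OfY (indY x ιB y) (T (liftY f E)) ≤ K y y' * (geo9Y x).l2Norm (.inl f)) :
    HasL2Majorant (g := toB6 (geo9Y x) R H) (fun p : SiteY x.toKIdx × ι => blkC x.toKIdx ιB p.1) (conj b T)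
      (fun a a' => (Real.sqrt (Fintype.card ι) * M₂ * ∑ j, ‖b j‖) * K a a') := by
  intro y y' u hu
  have hind := indY_nonneg_le_one x ιB y
  have h1 := l2n_blockPiece_conj_le x ιB b hM₂ hrepr R H T u y
  have hne : ∀ j, ‖b j‖ ≠ 0 := fun j => norm_ne_zero_iff.2 (b.ne_zero j)
  set uj : ι → SiteY x.toKIdx → ℝ := fun j z => ‖b j‖ * u (z, j) with huj
  set Ej : ι → 𝔸 := fun j => (‖b j‖⁻¹ : ℝ) • b j with hEj
  have hEj1 : ∀ j, ‖Ej j‖ ≤ 1 := fun j => by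
    rw [hEj]; dsimp only
    rw [norm_smul, norm_inv, Real.norm_eq_abs, abs_norm, inv_mul_cancel₀ (hne j)]
  -- `coord⁻¹ u = Σ_j (‖b_j‖u_j) ⊗ E_j`
  have hΛ : (coordEquiv b).symm u = ∑ j, liftY (uj j) (Ej j) := by
    rw [coordEquiv_symm_eq_sum_liftY b u]
    exact Finset.sum_congr rfl fun j _ => liftY_eq_liftY_unit _ (b.ne_zero j)
  have hTΛ : T ((coordEquiv b).symm u) = ∑ j, T (liftY (uj j) (Ej j)) := by rw [hΛ, map_sum]
  -- the 𝔸-valued block reading of `T Λ_u`, term by term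
  have h2 : l2OfY (indY x ιB y) (T ((coordEquiv b).symm u)) ≤ ∑ j, l2OfY (indY x ιB y) (T (liftY (uj j) (Ej j))) := by
    rw [hTΛ]; exact l2OfY_sum_le x (fun z => (hind z).1) Finset.univ _
  -- each term is read by the hypothesis
  have h3 : ∀ j, l2OfY (indY x ιB y) (T (liftY (uj j) (Ej j))) ≤ K y y' * (‖b j‖ * l2n u) := by
    intro j
    have hoff : ∀ z, blkC x.toKIdx ιB z ≠ y' → uj j z = 0 := fun z hz => by
      rw [huj]; dsimp only; rw [hu (z, j) hz, mul_zero]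
    refine (hT (uj j) (Ej j) y y' (hEj1 j) hoff).trans (mul_le_mul_of_nonneg_left ?_ (hK y y'))
    exact (l2Norm_smul_col_le x u j ‖b j‖).trans (by rw [abs_norm])
  have hSb : 0 ≤ ∑ j, ‖b j‖ := Finset.sum_nonneg fun _ _ => norm_nonneg _
  calc l2n (blockPiece (g := toB6 (geo9Y x) R H) (fun p : SiteY x.toKIdx × ι => blkC x.toKIdx ιB p.1) y (conj b T u))
      ≤ Real.sqrt (Fintype.card ι) * M₂ * l2OfY (indY x ιB y) (T ((coordEquiv b).symm u)) := h1
    _ ≤ Real.sqrt (Fintype.card ι) * M₂ * ∑ j, K y y' * (‖b j‖ * l2n u) :=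
        mul_le_mul_of_nonneg_left (h2.trans (Finset.sum_le_sum fun j _ => h3 j)) (by positivity)
    _ = (Real.sqrt (Fintype.card ι) * M₂ * ∑ j, ‖b j‖) * K y y' * l2n u := by
        rw [← Finset.mul_sum, ← Finset.sum_mul]; ring

omit [CompleteSpace 𝔸] [FiniteDimensional ℝ 𝔸] [Fintype (geo9Y x).Site] [DecidableEq (geo9Y x).Site] in
/-- the norm of a vector through its coordinates: `‖v‖ ≦ (Σ_j‖b_j‖)·(Σ_j (repr_j v)²)^{1/2}`. [cite: Balaban1984PropagatorsII, (2.51) p.232, bookkeeping] -/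
theorem norm_le_sum_mul_sqrt_repr (v : 𝔸) : ‖v‖ ≤ (∑ j, ‖b j‖) * Real.sqrt (∑ j, (b.repr v j) ^ 2) := by
  have hexp : v = ∑ j, (b.repr v j) • b j := (b.sum_repr v).symm
  have hj : ∀ j, |b.repr v j| ≤ Real.sqrt (∑ i, (b.repr v i) ^ 2) := fun j => by
    rw [← Real.sqrt_sq_eq_abs]
    exact Real.sqrt_le_sqrt (Finset.single_le_sum (fun i _ => sq_nonneg (b.repr v i)) (Finset.mem_univ j))
  calc ‖v‖ = ‖∑ j, (b.repr v j) • b j‖ := by rw [← hexp]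
    _ ≤ ∑ j, ‖(b.repr v j) • b j‖ := norm_sum_le _ _
    _ = ∑ j, |b.repr v j| * ‖b j‖ := Finset.sum_congr rfl fun j _ => by rw [norm_smul, Real.norm_eq_abs]
    _ ≤ ∑ j, Real.sqrt (∑ i, (b.repr v i) ^ 2) * ‖b j‖ := Finset.sum_le_sum fun j _ => mul_le_mul_of_nonneg_right (hj j) (norm_nonneg _)
    _ = (∑ j, ‖b j‖) * Real.sqrt (∑ j, (b.repr v j) ^ 2) := by rw [← Finset.mul_sum, mul_comm]

omit [CompleteSpace 𝔸] [FiniteDimensional ℝ 𝔸] [Fintype (geo9Y x).Site] [DecidableEq (geo9Y x).Site] in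
/-- the `ℓ²` size of the coordinates of a product-form input: `‖coord(f ⊗ E)‖₂ ≦ √|ι|·M₂·‖f‖` for `‖E‖ ≦ 1`. [cite: Balaban1984PropagatorsII, (2.51) p.232, bookkeeping] -/
theorem l2n_coordEquiv_liftY_le {M₂ : ℝ} (hM₂ : 0 ≤ M₂) (hrepr : ∀ (v : 𝔸) (j : ι), |b.repr v j| ≤ M₂ * ‖v‖)
    (f : SiteY x.toKIdx → ℝ) {E : 𝔸} (hE : ‖E‖ ≤ 1) :
    l2n (coordEquiv b (liftY f E)) ≤ Real.sqrt (Fintype.card ι) * M₂ * (geo9Y x).l2Norm (.inl f) := by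
  have hrhs : 0 ≤ Real.sqrt (Fintype.card ι) * M₂ * (geo9Y x).l2Norm (.inl f) :=
    mul_nonneg (by positivity) (B9GeoNormsKLevelV1.geo9K_l2Norm_nonneg x.toKIdx _)
  refine (pow_le_pow_iff_left₀ (l2n_nonneg _) hrhs two_ne_zero).1 ?_
  rw [l2n_sq, mul_pow, mul_pow, Real.sq_sqrt (Nat.cast_nonneg _), l2Norm_inl_eq, Real.sq_sqrt (Finset.sum_nonneg fun _ _ => sq_nonneg _),
    Fintype.sum_prod_type, Finset.mul_sum]
  refine Finset.sum_le_sum fun z _ => ?_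
  have hr : ∀ j, (b.repr E j) ^ 2 ≤ M₂ ^ 2 := fun j => by
    have h := hrepr E j
    have h1 : |b.repr E j| ≤ M₂ := h.trans (mul_le_of_le_one_right hM₂ hE)
    nlinarith [abs_nonneg (b.repr E j), sq_abs (b.repr E j)]
  calc ∑ j, (coordEquiv b (liftY f E) (z, j)) ^ 2 = ∑ j, f z ^ 2 * (b.repr E j) ^ 2 :=
        Finset.sum_congr rfl fun j _ => by rw [B9SectBGpReadingsY.coordEquiv_liftY]; ring
    _ ≤ ∑ _j : ι, f z ^ 2 * M₂ ^ 2 := Finset.sum_le_sum fun j _ => mul_le_mul_of_nonneg_left (hr j) (sq_nonneg _)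
    _ = (Fintype.card ι : ℝ) * M₂ ^ 2 * f z ^ 2 := by rw [Finset.sum_const, Finset.card_univ, nsmul_eq_mul]; ring

omit [NormedAlgebra ℂ 𝔸] [CompleteSpace 𝔸] [FiniteDimensional ℝ 𝔸] [Fintype ι] [Fintype (geo9Y x).Site] [DecidableEq (geo9Y x).Site] in
/-- the values of a scalar cut-off are below the reading's `|h|`. [cite: Balaban1985BackgroundPropagators, (3.46) p.398 («|h|»), bookkeeping] -/
theorem abs_le_cutSup_inl (h : SiteY x.toKIdx → ℝ) (z : SiteY x.toKIdx) : |h z| ≤ (geo9Y x).cutSup (.inl h) :=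
  le_ciSup (f := fun w : SiteY x.toKIdx => |h w|) (Set.finite_range _).bddAbove z

omit [NormedAlgebra ℂ 𝔸] [CompleteSpace 𝔸] [FiniteDimensional ℝ 𝔸] [Fintype ι] [Fintype (geo9Y x).Site] [DecidableEq (geo9Y x).Site] in
/-- a cut-off in the genuine block `β y` (the reading's «supp h ⊂ Δ(y)») vanishes off the labelled block `ιB (β y)` of the frame.
[cite: Balaban1985BackgroundPropagators, (3.46) p.398, bookkeeping] -/
theorem cut_off_of_cutIn_inl {h : SiteY x.toKIdx → ℝ} {y : IBondY x.toKIdx} (hc : (geo9Y x).cutIn (.inl h) y) (z : SiteY x.toKIdx)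
    (hz : blkC x.toKIdx ιB z ≠ ιB (β x.toKIdx.hN x.toKIdx.D x.toKIdx.hk y)) : h z = 0 := by
  by_contra hne
  exact hz (by rw [blkC, show blkY x.toKIdx z = _ from hc z hne])

omit [CompleteSpace 𝔸] [FiniteDimensional ℝ 𝔸] in
/-- ★ **`ℓ²` MAJORANT ⇒ READING** (the converse of `hasL2Majorant_conj_of_indBound`, [4] (2.140) with a general cut-off): a block-`ℓ²` majorant `K ≧ 0`
of `conj b T` bounds, for `‖E‖ ≦ 1`, `f` supported in the labelled block `y′`, `h` supported in the labelled block `y` with `|h| ≦ s`,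
`‖h·T(f ⊗ E)‖₂ ≦ c_L·K(y,y′)·s·‖f‖`, `c_L = √|ι|·M₂·Σ_j‖b_j‖`. [cite: Balaban1984PropagatorsII, Prop. 2.6 (2.140) p.247, (2.51) p.232; Balaban1985BackgroundPropagators, (3.46) p.398] -/
theorem l2OfY_liftY_le_of_hasL2Majorant_conj {M₂ : ℝ} (hM₂ : 0 ≤ M₂) (hrepr : ∀ (v : 𝔸) (j : ι), |b.repr v j| ≤ M₂ * ‖v‖) (R : ℝ) (H : Prop)
    (T : Module.End ℝ (SiteY x.toKIdx → 𝔸)) (K : IBondY x.toKIdx → IBondY x.toKIdx → ℝ)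
    (hT : HasL2Majorant (g := toB6 (geo9Y x) R H) (fun p : SiteY x.toKIdx × ι => blkC x.toKIdx ιB p.1) (conj b T) K)
    (f : SiteY x.toKIdx → ℝ) (E : 𝔸) (h : SiteY x.toKIdx → ℝ) (y y' : IBondY x.toKIdx) {s : ℝ} (hE : ‖E‖ ≤ 1) (hK : 0 ≤ K y y') (hs : 0 ≤ s)
    (hoff : ∀ z, blkC x.toKIdx ιB z ≠ y' → f z = 0) (hcut : ∀ z, blkC x.toKIdx ιB z ≠ y → h z = 0) (hhs : ∀ z, |h z| ≤ s) :
    l2OfY h (T (liftY f E)) ≤ (Real.sqrt (Fintype.card ι) * M₂ * ∑ j, ‖b j‖) * K y y' * s * (geo9Y x).l2Norm (.inl f) := by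
  letI : DecidableEq (toB6 (geo9Y x) R H).Site := ‹DecidableEq (geo9Y x).Site›
  set Λ := liftY f E with hΛ
  set μ : SiteY x.toKIdx × ι → ℝ := coordEquiv b Λ with hμ
  have hΛμ : (coordEquiv b).symm μ = Λ := by rw [hμ, LinearEquiv.symm_apply_apply]
  have hμoff : ∀ p : SiteY x.toKIdx × ι, blkC x.toKIdx ιB p.1 ≠ y' → μ p = 0 := fun p hp => by
    rw [hμ, B9SectBGpReadingsY.coordEquiv_liftY, hoff p.1 hp, zero_mul]
  -- the majorant on the source `μ`
  have hmaj := hT y y' μ hμoff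
  have hμn := l2n_coordEquiv_liftY_le x b hM₂ hrepr f hE
  set Sb := ∑ j, ‖b j‖ with hSb
  have hSb0 : 0 ≤ Sb := Finset.sum_nonneg fun _ _ => norm_nonneg _
  have hl2 : 0 ≤ (geo9Y x).l2Norm (.inl f) := B9GeoNormsKLevelV1.geo9K_l2Norm_nonneg x.toKIdx _
  set P := l2n (blockPiece (g := toB6 (geo9Y x) R H) (fun p : SiteY x.toKIdx × ι => blkC x.toKIdx ιB p.1) y (conj b T μ)) with hP
  have hP0 : 0 ≤ P := l2n_nonneg _
  -- pointwise: `‖TΛ(z)‖ ≤ Sb·(Σ_j repr_j²)^{1/2}` and the coordinates are the conj-`b` piece on the block `y`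
  have hrow : ∀ z, (h z * ‖T Λ z‖) ^ 2 ≤ s ^ 2 * Sb ^ 2 *
      ∑ j, (blockPiece (g := toB6 (geo9Y x) R H) (fun p : SiteY x.toKIdx × ι => blkC x.toKIdx ιB p.1) y (conj b T μ) (z, j)) ^ 2 := by
    intro z
    by_cases hz : blkC x.toKIdx ιB z = y
    · have hpc : ∀ j, blockPiece (g := toB6 (geo9Y x) R H) (fun p : SiteY x.toKIdx × ι => blkC x.toKIdx ιB p.1) y (conj b T μ) (z, j) = b.repr (T Λ z) j := by
        intro j
        rw [blockPiece]
        dsimp only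
        split_ifs with hc
        · rw [conj_apply, hΛμ]
        · exact absurd hz hc
      simp only [hpc]
      have hv := norm_le_sum_mul_sqrt_repr b (T Λ z)
      have hsq : 0 ≤ ∑ j, (b.repr (T Λ z) j) ^ 2 := Finset.sum_nonneg fun _ _ => sq_nonneg _
      have h1 : ‖T Λ z‖ ^ 2 ≤ Sb ^ 2 * ∑ j, (b.repr (T Λ z) j) ^ 2 := by
        calc ‖T Λ z‖ ^ 2 ≤ (Sb * Real.sqrt (∑ j, (b.repr (T Λ z) j) ^ 2)) ^ 2 := pow_le_pow_left₀ (norm_nonneg _) hv 2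
          _ = Sb ^ 2 * ∑ j, (b.repr (T Λ z) j) ^ 2 := by rw [mul_pow, Real.sq_sqrt hsq]
      have h2 : (h z) ^ 2 ≤ s ^ 2 := by
        have := hhs z; nlinarith [abs_nonneg (h z), sq_abs (h z)]
      calc (h z * ‖T Λ z‖) ^ 2 = (h z) ^ 2 * ‖T Λ z‖ ^ 2 := by ring
        _ ≤ s ^ 2 * (Sb ^ 2 * ∑ j, (b.repr (T Λ z) j) ^ 2) := mul_le_mul h2 h1 (sq_nonneg _) (sq_nonneg _)
        _ = _ := by ring
    · rw [hcut z hz, zero_mul, zero_pow two_ne_zero]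
      exact mul_nonneg (by positivity) (Finset.sum_nonneg fun _ _ => sq_nonneg _)
  have hsum : (l2OfY h (T Λ)) ^ 2 ≤ (s * Sb * P) ^ 2 := by
    rw [l2OfY, Real.sq_sqrt (Finset.sum_nonneg fun _ _ => sq_nonneg _), mul_pow, mul_pow, hP, l2n_sq, Fintype.sum_prod_type, Finset.mul_sum]
    exact Finset.sum_le_sum fun z _ => (hrow z).trans (le_of_eq (by ring))
  have hl : l2OfY h (T Λ) ≤ s * Sb * P := by
    have h0 : 0 ≤ s * Sb * P := by positivity
    exact (pow_le_pow_iff_left₀ (by unfold l2OfY; positivity) h0 two_ne_zero).1 hsum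
  calc l2OfY h (T Λ) ≤ s * Sb * P := hl
    _ ≤ s * Sb * (K y y' * l2n μ) := mul_le_mul_of_nonneg_left hmaj (by positivity)
    _ ≤ s * Sb * (K y y' * (Real.sqrt (Fintype.card ι) * M₂ * (geo9Y x).l2Norm (.inl f))) :=
        mul_le_mul_of_nonneg_left (mul_le_mul_of_nonneg_left hμn hK) (by positivity)
    _ = (Real.sqrt (Fintype.card ι) * M₂ * ∑ j, ‖b j‖) * K y y' * s * (geo9Y x).l2Norm (.inl f) := by rw [hSb]; ring

end Dictionary

/-! ### `ℓ²` reading helpers on any finite carrier -/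

section L2Helpers

omit [CompleteSpace 𝔸] [FiniteDimensional ℝ 𝔸] in
/-- homogeneity of the block `ℓ²` reading (any cut-off, any finite carrier). [cite: Balaban1985BackgroundPropagators, (3.46) p.398, bookkeeping] -/
theorem l2OfY_smul' {X : Type} [Fintype X] (h : X → ℝ) (c : ℂ) (Ψ : X → 𝔸) : l2OfY h (c • Ψ) = ‖c‖ * l2OfY h Ψ := by
  unfold l2OfY
  rw [← Real.sqrt_sq (norm_nonneg c), ← Real.sqrt_mul (sq_nonneg _)]
  congr 1
  rw [Finset.mul_sum]
  refine Finset.sum_congr rfl fun z _ => ?_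
  rw [Pi.smul_apply, norm_smul]; ring

omit [NormedAlgebra ℂ 𝔸] [CompleteSpace 𝔸] [FiniteDimensional ℝ 𝔸] in
/-- the block `ℓ²` reading under a pointwise bound of the function: `‖h·Ψ‖₂ ≦ (Σ_z (h(z)·C)²)^{1/2}` if `‖Ψ(z)‖ ≦ C`. [cite: Balaban1985BackgroundPropagators, (3.46) p.398, bookkeeping] -/
theorem l2OfY_le_of_pointwise {X : Type} [Fintype X] (h : X → ℝ) {Ψ : X → 𝔸} {C : ℝ} (hΨ : ∀ z, ‖Ψ z‖ ≤ C) :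
    l2OfY h Ψ ≤ Real.sqrt (∑ z, (h z * C) ^ 2) := by
  unfold l2OfY
  refine Real.sqrt_le_sqrt (Finset.sum_le_sum fun z _ => ?_)
  have h0 : 0 ≤ C := (norm_nonneg _).trans (hΨ z)
  have h1 : |h z * ‖Ψ z‖| ≤ |h z * C| := by
    rw [abs_mul, abs_mul, abs_of_nonneg (norm_nonneg _), abs_of_nonneg h0]
    exact mul_le_mul_of_nonneg_left (hΨ z) (abs_nonneg _)
  exact sq_le_sq.2 h1

end L2Helpers

/-! ## §1 The six `L²` words: the `𝔸`-side words `wordSL` (all sign combinations) and the frame-side composites `wordL` -/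

section Words

variable (i : KIdx d ℓ hd hL b₀ b₁)

/-- the covariant difference along a SIGNED direction `k ∈ κ ⊕ κ` at the base `U₀`: forward `∇_{U₀,μ}` (`inl μ`, (3.3)) or backward `∇*_{U₀,μ}`
(`inr μ`, (3.8)) — «we may always replace ∇_U by ∇*_U, and vice versa, in arbitrary place and combination» (p. 398).
[cite: Balaban1985BackgroundPropagators, (3.3) p.390, (3.8) p.392, p.398 (first remark after Thm 3.1)] -/
def dirS (U₀ : CfgY 𝔸 i) : Fin (d + 1) ⊕ Fin (d + 1) → (SiteY i → 𝔸) → SiteY i → 𝔸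
  | .inl μ => cdS i U₀ μ
  | .inr μ => cdsS i U₀ μ

omit [FiniteDimensional ℝ 𝔸] in
/-- additivity of the signed difference. [cite: Balaban1985BackgroundPropagators, (3.3) p.390, (3.8) p.392, bookkeeping] -/
theorem dirS_add (U₀ : CfgY 𝔸 i) (k : Fin (d + 1) ⊕ Fin (d + 1)) (Φ Ψ : SiteY i → 𝔸) :
    dirS i U₀ k (Φ + Ψ) = dirS i U₀ k Φ + dirS i U₀ k Ψ := by
  cases k with
  | inl μ => exact cdS_add i U₀ μ Φ Ψ
  | inr μ => exact cdsS_add i U₀ μ Φ Ψ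

omit [FiniteDimensional ℝ 𝔸] in
/-- `ℂ`-homogeneity of the signed difference. [cite: Balaban1985BackgroundPropagators, (3.3) p.390, (3.8) p.392, bookkeeping] -/
theorem dirS_smul (U₀ : CfgY 𝔸 i) (k : Fin (d + 1) ⊕ Fin (d + 1)) (c : ℂ) (Φ : SiteY i → 𝔸) :
    dirS i U₀ k (c • Φ) = c • dirS i U₀ k Φ := by
  cases k with
  | inl μ => exact cdS_smul i U₀ μ c Φ
  | inr μ => exact cdsS_smul i U₀ μ c Φ

/-- the signed difference as a `ℂ`-linear map. [cite: Balaban1985BackgroundPropagators, (3.3) p.390, (3.8) p.392, bookkeeping] -/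
def dirSL (U₀ : CfgY 𝔸 i) (k : Fin (d + 1) ⊕ Fin (d + 1)) : (SiteY i → 𝔸) →ₗ[ℂ] (SiteY i → 𝔸) where
  toFun := dirS i U₀ k
  map_add' := dirS_add i U₀ k
  map_smul' := dirS_smul i U₀ k

omit [FiniteDimensional ℝ 𝔸] in
/-- `dirSL` applied. [cite: Balaban1985BackgroundPropagators, (3.3) p.390, bookkeeping] -/
@[simp] theorem dirSL_apply (U₀ : CfgY 𝔸 i) (k : Fin (d + 1) ⊕ Fin (d + 1)) (Φ : SiteY i → 𝔸) : dirSL i U₀ k Φ = dirS i U₀ k Φ := rfl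

/-- ★ **THE SIX `𝔸`-SIDE `L²` WORDS** of a site-sector letter `O` (operator at `V`, differences at the base `U₀`, signed directions `k, l`):
`OΛ`, `∇♯_k(OΛ)`, `O(∇♯_kΛ)`, `∇♯_k∇♯_l(OΛ)`, `∇♯_k(O(∇♯_lΛ))`, `O(∇♯_k∇♯_lΛ)` — the quantities under the six `L²` norms of (3.46), in the order of the
frames' members `0 … 5` (left second differences = member 3, the mixed one = member 4), as `ℂ`-linear maps.
[cite: Balaban1985BackgroundPropagators, Thm 3.1 (3.46) p.398, p.398 (first remark), p.403 l.1–9] -/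
def wordSL (O : SiteOpY 𝔸 i) (U₀ V : CfgY 𝔸 i) (n : Fin 6) (k l : Fin (d + 1) ⊕ Fin (d + 1)) : (SiteY i → 𝔸) →ₗ[ℂ] (SiteY i → 𝔸) :=
  (![O V, dirSL i U₀ k ∘ₗ O V, O V ∘ₗ dirSL i U₀ k, dirSL i U₀ k ∘ₗ dirSL i U₀ l ∘ₗ O V, dirSL i U₀ k ∘ₗ O V ∘ₗ dirSL i U₀ l,
      O V ∘ₗ dirSL i U₀ k ∘ₗ dirSL i U₀ l] : Fin 6 → (SiteY i → 𝔸) →ₗ[ℂ] (SiteY i → 𝔸)) n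

omit [FiniteDimensional ℝ 𝔸] in
/-- the six words applied, member by member (definitional unfoldings). [cite: Balaban1985BackgroundPropagators, (3.46) p.398, bookkeeping] -/
theorem wordSL_apply (O : SiteOpY 𝔸 i) (U₀ V : CfgY 𝔸 i) (k l : Fin (d + 1) ⊕ Fin (d + 1)) (Λ : SiteY i → 𝔸) :
    wordSL i O U₀ V 0 k l Λ = O V Λ ∧ wordSL i O U₀ V 1 k l Λ = dirS i U₀ k (O V Λ) ∧ wordSL i O U₀ V 2 k l Λ = O V (dirS i U₀ k Λ) ∧
      wordSL i O U₀ V 3 k l Λ = dirS i U₀ k (dirS i U₀ l (O V Λ)) ∧ wordSL i O U₀ V 4 k l Λ = dirS i U₀ k (O V (dirS i U₀ l Λ)) ∧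
      wordSL i O U₀ V 5 k l Λ = O V (dirS i U₀ k (dirS i U₀ l Λ)) :=
  ⟨rfl, rfl, rfl, rfl, rfl, rfl⟩

omit [FiniteDimensional ℝ 𝔸] in
/-- the signed difference on a forward resp. backward direction is `∇_{U₀,μ}` resp. `∇*_{U₀,μ}` (definitional). [cite: Balaban1985BackgroundPropagators, (3.3) p.390, (3.8) p.392, bookkeeping] -/
theorem dirS_inl_inr (U₀ : CfgY 𝔸 i) (μ : Fin (d + 1)) (Φ : SiteY i → 𝔸) :
    dirS i U₀ (Sum.inl μ) Φ = cdS i U₀ μ Φ ∧ dirS i U₀ (Sum.inr μ) Φ = cdsS i U₀ μ Φ := ⟨rfl, rfl⟩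

/-- ★ **THE SIX FRAME-SIDE COMPOSITES** (the letters whose `conj b` the frames' `L²` fields read∕write): with `D_k = diffLetter T (U₀-coordinates) η⁻¹ k` and
`G = η²·O(V)`: `G`, `D_k·G`, `G·D_k`, `D_k·D_l·G`, `D_k·G·D_l`, `G·D_k·D_l`. [cite: Balaban1985BackgroundPropagators, Thm 3.1 (3.46) p.398, p.403 l.1–9] -/
def wordL (O : SiteOpY 𝔸 i) (U₀ V : CfgY 𝔸 i) (η : ℝ) (n : Fin 6) (k l : Fin (d + 1) ⊕ Fin (d + 1)) : Module.End ℝ (SiteY i → 𝔸) :=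
  (![(η ^ 2) • (O V).restrictScalars ℝ,
      diffLetter (shiftY i) (UboxY i U₀) (((η : ℂ))⁻¹) k * (η ^ 2) • (O V).restrictScalars ℝ,
      (η ^ 2) • (O V).restrictScalars ℝ * diffLetter (shiftY i) (UboxY i U₀) (((η : ℂ))⁻¹) k,
      diffLetter (shiftY i) (UboxY i U₀) (((η : ℂ))⁻¹) k * diffLetter (shiftY i) (UboxY i U₀) (((η : ℂ))⁻¹) l * (η ^ 2) • (O V).restrictScalars ℝ,
      diffLetter (shiftY i) (UboxY i U₀) (((η : ℂ))⁻¹) k * (η ^ 2) • (O V).restrictScalars ℝ * diffLetter (shiftY i) (UboxY i U₀) (((η : ℂ))⁻¹) l,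
      (η ^ 2) • (O V).restrictScalars ℝ * diffLetter (shiftY i) (UboxY i U₀) (((η : ℂ))⁻¹) k * diffLetter (shiftY i) (UboxY i U₀) (((η : ℂ))⁻¹) l] :
    Fin 6 → Module.End ℝ (SiteY i → 𝔸)) n

/-- the `η`-exponents `(2, 1, 1, 0, 0, 0)` of the six `L²` members (print's prefactors `[(Lʲη)², Lʲη, Lʲη, 1, 1, 1]` in lattice units).
[cite: Balaban1985BackgroundPropagators, Thm 3.1 (3.46) p.398] -/
def e6 : Fin 6 → ℕ := ![2, 1, 1, 0, 0, 0]

/-- the scalar of the frames' difference letter along `k`: `η⁻¹` forward, `−η⁻¹` backward. [cite: Balaban1985BackgroundPropagators, (3.3) p.390, (3.8) p.392, (3.52) p.400, bookkeeping] -/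
def dσ (η : ℝ) : Fin (d + 1) ⊕ Fin (d + 1) → ℂ
  | .inl _ => ((η : ℂ))⁻¹
  | .inr _ => -((η : ℂ))⁻¹

/-- the scalar relating the frame-side composite to the `𝔸`-side word, member by member. [cite: Balaban1985BackgroundPropagators, (3.46) p.398, bookkeeping] -/
def wσ (η : ℝ) (n : Fin 6) (k l : Fin (d + 1) ⊕ Fin (d + 1)) : ℂ :=
  (![(((η ^ 2 : ℝ)) : ℂ), dσ (d := d) η k * (((η ^ 2 : ℝ)) : ℂ), (((η ^ 2 : ℝ)) : ℂ) * dσ (d := d) η k,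
      dσ (d := d) η k * (dσ (d := d) η l * (((η ^ 2 : ℝ)) : ℂ)), dσ (d := d) η k * ((((η ^ 2 : ℝ)) : ℂ) * dσ (d := d) η l),
      (((η ^ 2 : ℝ)) : ℂ) * (dσ (d := d) η k * dσ (d := d) η l)] : Fin 6 → ℂ) n

omit [NormedRing 𝔸] [NormedAlgebra ℂ 𝔸] [CompleteSpace 𝔸] [FiniteDimensional ℝ 𝔸] in
/-- `‖dσ η k‖ = η⁻¹`. [cite: Balaban1985BackgroundPropagators, (3.3) p.390, bookkeeping] -/
theorem norm_dσ {η : ℝ} (hη : 0 < η) (k : Fin (d + 1) ⊕ Fin (d + 1)) : ‖dσ (d := d) η k‖ = η⁻¹ := by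
  cases k with
  | inl μ => rw [dσ, norm_inv, Complex.norm_real, Real.norm_eq_abs, abs_of_pos hη]
  | inr μ => rw [dσ, norm_neg, norm_inv, Complex.norm_real, Real.norm_eq_abs, abs_of_pos hη]

omit [NormedRing 𝔸] [NormedAlgebra ℂ 𝔸] [CompleteSpace 𝔸] [FiniteDimensional ℝ 𝔸] in
/-- `‖wσ η n k l‖ = η^{e_n}`. [cite: Balaban1985BackgroundPropagators, (3.46) p.398 (the prefactors), bookkeeping] -/
theorem norm_wσ {η : ℝ} (hη : 0 < η) (n : Fin 6) (k l : Fin (d + 1) ⊕ Fin (d + 1)) : ‖wσ (d := d) η n k l‖ = η ^ e6 n := by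
  have h2 : ‖((((η ^ 2 : ℝ)) : ℂ))‖ = η ^ 2 := by rw [Complex.norm_real, Real.norm_eq_abs, abs_of_nonneg (by positivity)]
  have hk := norm_dσ (d := d) hη k
  have hl := norm_dσ (d := d) hη l
  have hη0 : η ≠ 0 := hη.ne'
  match n with
  | 0 => show ‖((((η ^ 2 : ℝ)) : ℂ))‖ = η ^ 2; exact h2
  | 1 => show ‖dσ (d := d) η k * (((η ^ 2 : ℝ)) : ℂ)‖ = η ^ 1; rw [norm_mul, hk, h2]; field_simp
  | 2 => show ‖(((η ^ 2 : ℝ)) : ℂ) * dσ (d := d) η k‖ = η ^ 1; rw [norm_mul, hk, h2]; field_simp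
  | 3 => show ‖dσ (d := d) η k * (dσ (d := d) η l * (((η ^ 2 : ℝ)) : ℂ))‖ = η ^ 0; rw [norm_mul, norm_mul, hk, hl, h2]; field_simp
  | 4 => show ‖dσ (d := d) η k * ((((η ^ 2 : ℝ)) : ℂ) * dσ (d := d) η l)‖ = η ^ 0; rw [norm_mul, norm_mul, hk, hl, h2]; field_simp
  | 5 => show ‖(((η ^ 2 : ℝ)) : ℂ) * (dσ (d := d) η k * dσ (d := d) η l)‖ = η ^ 0; rw [norm_mul, norm_mul, hk, hl, h2]; field_simp

omit [FiniteDimensional ℝ 𝔸] in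
/-- the frames' difference letter along `k` IS the signed difference up to the scalar `dσ`. [cite: Balaban1985BackgroundPropagators, (3.3) p.390, (3.8) p.392, (3.52) p.400] -/
theorem diffLetter_apply_eq_smul_dirS (U₀ : CfgY 𝔸 i) (η : ℝ) (k : Fin (d + 1) ⊕ Fin (d + 1)) (Λ : SiteY i → 𝔸) :
    diffLetter (shiftY i) (UboxY i U₀) (((η : ℂ))⁻¹) k Λ = dσ (d := d) η k • dirS i U₀ k Λ := by
  cases k with
  | inl μ => funext w; rw [B9Eq352GradLetters.diffLetter_inl, B9Eq352DivFormLetters.gradLetterF_apply]; rfl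
  | inr μ =>
    funext w
    rw [B9Eq352GradLetters.diffLetter_inr, LinearMap.neg_apply, Pi.neg_apply, B9Eq352DivFormLetters.gradLetterB_apply, Pi.smul_apply, dσ, neg_smul]
    rfl

omit [FiniteDimensional ℝ 𝔸] in
/-- ★ **THE FRAME-SIDE COMPOSITE IS THE `𝔸`-SIDE WORD UP TO THE SCALAR `wσ`.** [cite: Balaban1985BackgroundPropagators, (3.46) p.398, (3.3) p.390, (3.8) p.392, p.403 l.1–9] -/
theorem wordL_apply (O : SiteOpY 𝔸 i) (U₀ V : CfgY 𝔸 i) (η : ℝ) (n : Fin 6) (k l : Fin (d + 1) ⊕ Fin (d + 1)) (Λ : SiteY i → 𝔸) :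
    wordL i O U₀ V η n k l Λ = wσ (d := d) η n k l • wordSL i O U₀ V n k l Λ := by
  have hG : ∀ Φ : SiteY i → 𝔸, ((η ^ 2) • (O V).restrictScalars ℝ) Φ = ((((η ^ 2 : ℝ)) : ℂ)) • O V Φ := fun Φ => by
    rw [LinearMap.smul_apply, LinearMap.restrictScalars_apply, real_smul_fun]
  have hD := diffLetter_apply_eq_smul_dirS i U₀ η
  match n with
  | 0 => exact hG Λ
  | 1 =>
    show (diffLetter (shiftY i) (UboxY i U₀) (((η : ℂ))⁻¹) k * (η ^ 2) • (O V).restrictScalars ℝ) Λ = (dσ (d := d) η k * (((η ^ 2 : ℝ)) : ℂ)) • dirS i U₀ k (O V Λ)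
    simp only [Module.End.mul_apply, hG, hD, dirS_smul, smul_smul]
  | 2 =>
    show ((η ^ 2) • (O V).restrictScalars ℝ * diffLetter (shiftY i) (UboxY i U₀) (((η : ℂ))⁻¹) k) Λ = ((((η ^ 2 : ℝ)) : ℂ) * dσ (d := d) η k) • O V (dirS i U₀ k Λ)
    simp only [Module.End.mul_apply, hD, hG, map_smul, smul_smul]
  | 3 =>
    show (diffLetter (shiftY i) (UboxY i U₀) (((η : ℂ))⁻¹) k * diffLetter (shiftY i) (UboxY i U₀) (((η : ℂ))⁻¹) l * (η ^ 2) • (O V).restrictScalars ℝ) Λ =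
      (dσ (d := d) η k * (dσ (d := d) η l * (((η ^ 2 : ℝ)) : ℂ))) • dirS i U₀ k (dirS i U₀ l (O V Λ))
    simp only [Module.End.mul_apply, hG, hD, dirS_smul, smul_smul]
  | 4 =>
    show (diffLetter (shiftY i) (UboxY i U₀) (((η : ℂ))⁻¹) k * (η ^ 2) • (O V).restrictScalars ℝ * diffLetter (shiftY i) (UboxY i U₀) (((η : ℂ))⁻¹) l) Λ =
      (dσ (d := d) η k * ((((η ^ 2 : ℝ)) : ℂ) * dσ (d := d) η l)) • dirS i U₀ k (O V (dirS i U₀ l Λ))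
    simp only [Module.End.mul_apply, hD, hG, map_smul, dirS_smul, smul_smul]
  | 5 =>
    show ((η ^ 2) • (O V).restrictScalars ℝ * diffLetter (shiftY i) (UboxY i U₀) (((η : ℂ))⁻¹) k * diffLetter (shiftY i) (UboxY i U₀) (((η : ℂ))⁻¹) l) Λ =
      ((((η ^ 2 : ℝ)) : ℂ) * (dσ (d := d) η k * dσ (d := d) η l)) • O V (dirS i U₀ k (dirS i U₀ l Λ))
    simp only [Module.End.mul_apply, hD, dirS_smul, hG, map_smul, smul_smul]

omit [FiniteDimensional ℝ 𝔸] in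
/-- ★ **THE NORM IDENTITY**: `‖(wordL … n k l)Λ(z)‖ = η^{e_n}·‖(wordSL … n k l)Λ(z)‖` (`η > 0`). [cite: Balaban1985BackgroundPropagators, (3.46) p.398 (the prefactors η^{(2,1,1,0,0,0)} in lattice units)] -/
theorem norm_wordL_apply (O : SiteOpY 𝔸 i) (U₀ V : CfgY 𝔸 i) {η : ℝ} (hη : 0 < η) (n : Fin 6) (k l : Fin (d + 1) ⊕ Fin (d + 1))
    (Λ : SiteY i → 𝔸) (z : SiteY i) : ‖wordL i O U₀ V η n k l Λ z‖ = η ^ e6 n * ‖wordSL i O U₀ V n k l Λ z‖ := by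
  rw [wordL_apply, Pi.smul_apply, norm_smul, norm_wσ (d := d) hη]

omit [FiniteDimensional ℝ 𝔸] in
/-- the `L²` reading of the frame-side composite is `η^{e_n}` times that of the word (any cut-off). [cite: Balaban1985BackgroundPropagators, (3.46) p.398, bookkeeping] -/
theorem l2OfY_wordL (O : SiteOpY 𝔸 i) (U₀ V : CfgY 𝔸 i) {η : ℝ} (hη : 0 < η) (n : Fin 6) (k l : Fin (d + 1) ⊕ Fin (d + 1))
    (Λ : SiteY i → 𝔸) (h : SiteY i → ℝ) : l2OfY h (wordL i O U₀ V η n k l Λ) = η ^ e6 n * l2OfY h (wordSL i O U₀ V n k l Λ) := by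
  rw [wordL_apply, l2OfY_smul', norm_wσ (d := d) hη]

end Words

/-! ## §2 The augmented `L²` reading `l2AugS` and ★★ its two-way dictionary -/

section Aug

variable (i : KIdx d ℓ hd hL b₀ b₁)

/-- the six AUGMENTED `L²` entries at (base `U₀`, configuration `V`, input `Λ`, cut-off `h`): `sup_{k,l} ‖h·wordS_n(k,l)Λ‖₂` — all sign combinations of
the differences. [cite: Balaban1985BackgroundPropagators, Thm 3.1 (3.46) p.398, p.398 (first remark after Thm 3.1)] -/
def l2LatSC (O : SiteOpY 𝔸 i) (U₀ V : CfgY 𝔸 i) (Λ : SiteY i → 𝔸) (h : SiteY i → ℝ) (n : Fin 6) : ℝ :=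
  ⨆ p : (Fin (d + 1) ⊕ Fin (d + 1)) × (Fin (d + 1) ⊕ Fin (d + 1)), l2OfY h (wordSL i O U₀ V n p.1 p.2 Λ)

/-- ★ **THE AUGMENTED `L²` READING** of a site-sector letter `O` over a backgrounds record whose configurations decode to coded configurations (`cfg`): member
`n` = `η^{e_n}·sup_E l2LatSC_n` at (base `baseY (cfg c)`, decoding `decY (cfg c)`) ON (`.inl f`, `.inl h`), `0` OFF — the `L²` analogue of the augmented
(3.42) entries of `B9SectBGpReadingsY.kernelFamilySC`. [cite: Balaban1985BackgroundPropagators, Thm 3.1 (3.46) p.398, p.403 l.1–9 (letters at U)] -/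
def l2AugS {B : B9.Backgrounds} (cfg : B.Cfg → CCfg (CfgY 𝔸 i) (AfldY 𝔸 i)) (O : SiteOpY 𝔸 i) :
    Fin 6 → B.Cfg → (B9GeoNormsKLevelV1.geo9K i).Loc → (B9GeoNormsKLevelV1.geo9K i).Cut → ℝ :=
  fun n c lam h => match lam, h with
    | .inl f, .inl hh => etaS i ^ e6 n * ⨆ E : BallY 𝔸, l2LatSC i O (baseY i (cfg c)) (decY i (cfg c)) (liftY f (E : 𝔸)) hh n
    | _, _ => 0

omit [FiniteDimensional ℝ 𝔸] in
/-- `l2AugS` ON. [cite: Balaban1985BackgroundPropagators, (3.46) p.398, bookkeeping] -/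
theorem l2AugS_inl {B : B9.Backgrounds} (cfg : B.Cfg → CCfg (CfgY 𝔸 i) (AfldY 𝔸 i)) (O : SiteOpY 𝔸 i) (n : Fin 6) (c : B.Cfg) (f hh : SiteY i → ℝ) :
    l2AugS i cfg O n c (.inl f) (.inl hh) = etaS i ^ e6 n * ⨆ E : BallY 𝔸, l2LatSC i O (baseY i (cfg c)) (decY i (cfg c)) (liftY f (E : 𝔸)) hh n := rfl

end Aug

section AugDictionary

variable (x : MemberY d ℓ hd hL b₀ b₁ Mstar) (ιB : BlkY x.toKIdx → IBondY x.toKIdx) {ι : Type} [Fintype ι] (b : Module.Basis ι ℝ 𝔸)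
  [Fintype (geo9Y x).Site] [DecidableEq (geo9Y x).Site]

omit [Fintype (geo9Y x).Site] [DecidableEq (geo9Y x).Site] in
/-- the augmented entries of a product-form input are bounded uniformly over the unit ball (finite dimension), for any cut-off.
[cite: Balaban1985BackgroundPropagators, (3.46) p.398, bookkeeping] -/
theorem exists_ball_bound_l2LatSC (O : SiteOpY 𝔸 x.toKIdx) (U₀ V : CfgY 𝔸 x.toKIdx) (f h : SiteY x.toKIdx → ℝ) (n : Fin 6) :
    ∃ C : ℝ, ∀ E : BallY 𝔸, l2LatSC x.toKIdx O U₀ V (liftY f (E : 𝔸)) h n ≤ C := by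
  have hp : ∀ p : (Fin (d + 1) ⊕ Fin (d + 1)) × (Fin (d + 1) ⊕ Fin (d + 1)), ∃ C : ℝ, ∀ E : BallY 𝔸,
      l2OfY h (wordSL x.toKIdx O U₀ V n p.1 p.2 (liftY f (E : 𝔸))) ≤ C := by
    intro p
    obtain ⟨C₀, -, hC₀⟩ := exists_ball_bound x ((wordSL x.toKIdx O U₀ V n p.1 p.2).restrictScalars ℝ) f
    exact ⟨Real.sqrt (∑ z, (h z * C₀) ^ 2), fun E => l2OfY_le_of_pointwise h fun z => hC₀ E z⟩
  choose C hC using hp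
  exact ⟨⨆ p, C p, fun E => ciSup_mono (Set.finite_range _).bddAbove fun p => hC p E⟩

/-- ★★ **READ: THE AUGMENTED MEMBER `n` BOUNDS EVERY FRAME-SIDE COMPOSITE OF MEMBER `n` IN `ℓ²`.**  If member `n` of `l2AugS` at the configuration `c` satisfies its
(3.46) block with `(B₀, δ)` (`B₀ ≧ 0`), then for all signed directions `k, l` the letter `conj b (wordL_n(k,l))` — base `baseY (cfg c)`, operator at
`decY (cfg c)`, `η` the geometry's — has the block-`ℓ²` majorant `c_L·B₀·pref6_n(ℓ(a))·e^{−δd(a,a′)}`, `c_L = √|ι|·M₂·Σ_j‖b_j‖`.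
[cite: Balaban1985BackgroundPropagators, Thm 3.1 (3.46) p.398; Balaban1984PropagatorsII, Prop. 2.6 (2.140) p.247, (2.51) p.232] -/
theorem hasL2Majorant_wordL_of_l2AugS (hι : ∀ s : BlkY x.toKIdx, β x.toKIdx.hN x.toKIdx.D x.toKIdx.hk (ιB s) = s)
    {M₂ : ℝ} (hM₂ : 0 ≤ M₂) (hrepr : ∀ (v : 𝔸) (j : ι), |b.repr v j| ≤ M₂ * ‖v‖) (R : ℝ) (H : Prop)
    {B : B9.Backgrounds} (cfg : B.Cfg → CCfg (CfgY 𝔸 x.toKIdx) (AfldY 𝔸 x.toKIdx)) (O : SiteOpY 𝔸 x.toKIdx) {B₀ δ : ℝ} (hB₀ : 0 ≤ B₀) {c : B.Cfg} (n : Fin 6)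
    (hL2 : ∀ (lam : (geo9Y x).Loc) (h : (geo9Y x).Cut) (y y' : IBondY x.toKIdx), (geo9Y x).cutIn h y → (geo9Y x).suppIn lam y' →
      l2AugS x.toKIdx cfg O n c lam h ≤ B₀ * B9.pref6 ((geo9Y x).len y) n * (geo9Y x).cutSup h * Real.exp (-(δ * (geo9Y x).dist y y')) * (geo9Y x).l2Norm lam)
    (k l : Fin (d + 1) ⊕ Fin (d + 1)) :
    HasL2Majorant (g := toB6 (geo9Y x) R H) (fun p : SiteY x.toKIdx × ι => blkC x.toKIdx ιB p.1)
      (conj b (wordL x.toKIdx O (baseY x.toKIdx (cfg c)) (decY x.toKIdx (cfg c)) (kGeo x.toKIdx).eta n k l))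
      (fun a a' => (Real.sqrt (Fintype.card ι) * M₂ * ∑ j, ‖b j‖) * B₀ * B9.pref6 ((geo9Y x).len a) n * Real.exp (-(δ * (geo9Y x).dist a a'))) := by
  set η := (kGeo x.toKIdx).eta with hηdef
  have hη0 : 0 < η := geo9K_eta_pos x.toKIdx
  set U₀ := baseY x.toKIdx (cfg c) with hU₀
  set V := decY x.toKIdx (cfg c) with hV
  have hK0 : ∀ a a' : IBondY x.toKIdx, 0 ≤ B₀ * B9.pref6 ((geo9Y x).len a) n * Real.exp (-(δ * (geo9Y x).dist a a')) := fun a a' =>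
    mul_nonneg (mul_nonneg hB₀ (pref6_nonneg (geo9Y_len_pos x a).le n)) (Real.exp_pos _).le
  have h := hasL2Majorant_conj_of_indBound x ιB b hM₂ hrepr R H (wordL x.toKIdx O U₀ V η n k l)
    (fun a a' => B₀ * B9.pref6 ((geo9Y x).len a) n * Real.exp (-(δ * (geo9Y x).dist a a'))) hK0 ?_
  · exact B6RandomWalkL2.hasL2Majorant_mono _ h fun a a' => le_of_eq (by ring)
  intro f E y y' hE1 hoff
  have hind := indY_nonneg_le_one x ιB y
  -- the composite is `η^{e_n}` times the word, the word is below the augmented entry, the entry below the sup over the ball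
  rw [l2OfY_wordL x.toKIdx O U₀ V hη0]
  have h1 : l2OfY (indY x ιB y) (wordSL x.toKIdx O U₀ V n k l (liftY f E)) ≤ l2LatSC x.toKIdx O U₀ V (liftY f E) (indY x ιB y) n :=
    le_ciSup (f := fun p : (Fin (d + 1) ⊕ Fin (d + 1)) × (Fin (d + 1) ⊕ Fin (d + 1)) => l2OfY (indY x ιB y) (wordSL x.toKIdx O U₀ V n p.1 p.2 (liftY f E)))
      (Set.finite_range _).bddAbove (k, l)
  have h2 : l2LatSC x.toKIdx O U₀ V (liftY f E) (indY x ιB y) n ≤ ⨆ E' : BallY 𝔸, l2LatSC x.toKIdx O U₀ V (liftY f (E' : 𝔸)) (indY x ιB y) n :=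
    le_iSup_ball (A := fun E' : BallY 𝔸 => l2LatSC x.toKIdx O U₀ V (liftY f (E' : 𝔸)) (indY x ιB y) n)
      (exists_ball_bound_l2LatSC x O U₀ V f (indY x ιB y) n) ⟨E, mem_closedBall_zero_iff.2 hE1⟩
  -- the member's block at `(λ = f, h = 1_{Δ(y)})`
  have hread := hL2 (.inl f) (.inl (indY x ιB y)) y y' (cutIn_indY x ιB hι y) (suppIn_inl_of_blkC x ιB hι hoff)
  rw [l2AugS_inl, etaS_eq_eta] at hread
  have hcut : (geo9Y x).cutSup (.inl (indY x ιB y)) ≤ 1 := supF_indY_le_one x ιB y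
  have hl2n : 0 ≤ (geo9Y x).l2Norm (.inl f) := B9GeoNormsKLevelV1.geo9K_l2Norm_nonneg x.toKIdx _
  have hK := hK0 y y'
  calc η ^ e6 n * l2OfY (indY x ιB y) (wordSL x.toKIdx O U₀ V n k l (liftY f E))
      ≤ η ^ e6 n * ⨆ E' : BallY 𝔸, l2LatSC x.toKIdx O U₀ V (liftY f (E' : 𝔸)) (indY x ιB y) n :=
        mul_le_mul_of_nonneg_left (h1.trans h2) (pow_nonneg hη0.le _)
    _ ≤ B₀ * B9.pref6 ((geo9Y x).len y) n * (geo9Y x).cutSup (.inl (indY x ιB y)) * Real.exp (-(δ * (geo9Y x).dist y y')) *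
          (geo9Y x).l2Norm (.inl f) := hread
    _ ≤ B₀ * B9.pref6 ((geo9Y x).len y) n * 1 * Real.exp (-(δ * (geo9Y x).dist y y')) * (geo9Y x).l2Norm (.inl f) := by
        have h0 : 0 ≤ B₀ * B9.pref6 ((geo9Y x).len y) n := mul_nonneg hB₀ (pref6_nonneg (geo9Y_len_pos x y).le n)
        gcongr
    _ = B₀ * B9.pref6 ((geo9Y x).len y) n * Real.exp (-(δ * (geo9Y x).dist y y')) * (geo9Y x).l2Norm (.inl f) := by ring

omit [FiniteDimensional ℝ 𝔸] in
/-- ★★ **WRITE: BLOCK-`ℓ²` MAJORANTS OF THE COMPOSITES OF MEMBER `n` BOUND THE AUGMENTED MEMBER `n`.**  If for all signed directions `k, l` the letter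
`conj b (wordL_n(k,l))` (base `baseY (cfg c)`, operator at `decY (cfg c)`) has the block-`ℓ²` majorant `B·pref6_n(ℓ(a))·e^{−δd(a,a′)}` (`B ≧ 0`), then member `n`
of `l2AugS` at `c` satisfies its (3.46) block with `(c_L·B, δ)`. [cite: Balaban1985BackgroundPropagators, Thm 3.1 (3.46) p.398, p.403 («of course with different constants»); Balaban1984PropagatorsII, Prop. 2.6 (2.140) p.247] -/
theorem l2AugS_le_of_hasL2Majorant_wordL (hι : ∀ s : BlkY x.toKIdx, β x.toKIdx.hN x.toKIdx.D x.toKIdx.hk (ιB s) = s)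
    {M₂ : ℝ} (hM₂ : 0 ≤ M₂) (hrepr : ∀ (v : 𝔸) (j : ι), |b.repr v j| ≤ M₂ * ‖v‖) (R : ℝ) (H : Prop)
    {B : B9.Backgrounds} (cfg : B.Cfg → CCfg (CfgY 𝔸 x.toKIdx) (AfldY 𝔸 x.toKIdx)) (O : SiteOpY 𝔸 x.toKIdx) {B' δ : ℝ} (hB' : 0 ≤ B') {c : B.Cfg} (n : Fin 6)
    (hW : ∀ k l : Fin (d + 1) ⊕ Fin (d + 1), HasL2Majorant (g := toB6 (geo9Y x) R H) (fun p : SiteY x.toKIdx × ι => blkC x.toKIdx ιB p.1)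
      (conj b (wordL x.toKIdx O (baseY x.toKIdx (cfg c)) (decY x.toKIdx (cfg c)) (kGeo x.toKIdx).eta n k l))
      (fun a a' => B' * B9.pref6 ((geo9Y x).len a) n * Real.exp (-(δ * (geo9Y x).dist a a'))))
    (lam : (geo9Y x).Loc) (h : (geo9Y x).Cut) (y y' : IBondY x.toKIdx) (hcut : (geo9Y x).cutIn h y) (hsupp : (geo9Y x).suppIn lam y') :
    l2AugS x.toKIdx cfg O n c lam h ≤ ((Real.sqrt (Fintype.card ι) * M₂ * ∑ j, ‖b j‖) * B') * B9.pref6 ((geo9Y x).len y) n * (geo9Y x).cutSup h *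
      Real.exp (-(δ * (geo9Y x).dist y y')) * (geo9Y x).l2Norm lam := by
  set η := (kGeo x.toKIdx).eta with hηdef
  have hη0 : 0 < η := geo9K_eta_pos x.toKIdx
  set U₀ := baseY x.toKIdx (cfg c) with hU₀
  set V := decY x.toKIdx (cfg c) with hV
  set cL : ℝ := Real.sqrt (Fintype.card ι) * M₂ * ∑ j, ‖b j‖ with hcL
  have hcL0 : 0 ≤ cL := by positivity
  have hpref : 0 ≤ B9.pref6 ((geo9Y x).len y) n := pref6_nonneg (geo9Y_len_pos x y).le n
  have hcs : 0 ≤ (geo9Y x).cutSup h := B9GeoNormsKLevelV1.geo9K_cutSup_nonneg x.toKIdx h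
  have hl2n : 0 ≤ (geo9Y x).l2Norm lam := B9GeoNormsKLevelV1.geo9K_l2Norm_nonneg x.toKIdx lam
  set ex := Real.exp (-(δ * (geo9Y x).dist y y')) with hex
  have hex0 : 0 ≤ ex := (Real.exp_pos _).le
  have hRHS : 0 ≤ (cL * B') * B9.pref6 ((geo9Y x).len y) n * (geo9Y x).cutSup h * ex * (geo9Y x).l2Norm lam := by positivity
  match lam, h with
  | .inr _, .inl _ => exact hRHS
  | .inr _, .inr _ => exact hRHS
  | .inl _, .inr _ => exact hRHS
  | .inl f, .inl hh =>
    rw [l2AugS_inl, etaS_eq_eta]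
    set ŷ := ιB (β x.toKIdx.hN x.toKIdx.D x.toKIdx.hk y) with hŷ
    set ŷ' := ιB (β x.toKIdx.hN x.toKIdx.D x.toKIdx.hk y') with hŷ'
    have hoff : ∀ w, blkC x.toKIdx ιB w ≠ ŷ' → f w = 0 := off_of_suppIn_inl x ιB hsupp
    have hco : ∀ w, blkC x.toKIdx ιB w ≠ ŷ → hh w = 0 := cut_off_of_cutIn_inl x ιB hcut
    have hhs : ∀ w, |hh w| ≤ (geo9Y x).cutSup (.inl hh) := abs_le_cutSup_inl x hh
    have hK : B' * B9.pref6 ((geo9Y x).len ŷ) n * Real.exp (-(δ * (geo9Y x).dist ŷ ŷ')) = B' * B9.pref6 ((geo9Y x).len y) n * ex := by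
      rw [hŷ, hŷ', len_label x ιB hι, dist_label x ιB hι]
    set M := (cL * B') * B9.pref6 ((geo9Y x).len y) n * (geo9Y x).cutSup (.inl hh) * ex * (geo9Y x).l2Norm (.inl f) with hM
    -- every direction `E` of the ball and every sign pair: the composite's reading is below `M`
    have hdir : ∀ (E : BallY 𝔸) (p : (Fin (d + 1) ⊕ Fin (d + 1)) × (Fin (d + 1) ⊕ Fin (d + 1))),
        η ^ e6 n * l2OfY hh (wordSL x.toKIdx O U₀ V n p.1 p.2 (liftY f (E : 𝔸))) ≤ M := by
      intro E p
      have hE1 : ‖(E : 𝔸)‖ ≤ 1 := mem_closedBall_zero_iff.1 E.2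
      rw [← l2OfY_wordL x.toKIdx O U₀ V hη0]
      have hw := l2OfY_liftY_le_of_hasL2Majorant_conj x ιB b hM₂ hrepr R H _ _ (hW p.1 p.2) f (E : 𝔸) hh ŷ ŷ' hE1
        (by rw [hK]; positivity) hcs hoff hco hhs
      rw [hK] at hw
      exact hw.trans (le_of_eq (by rw [hM]; ring))
    have hM0 : 0 ≤ M := hRHS
    have hsup : (⨆ E : BallY 𝔸, l2LatSC x.toKIdx O U₀ V (liftY f (E : 𝔸)) hh n) ≤ M / η ^ e6 n := by
      refine Real.iSup_le (fun E => Real.iSup_le (fun p => ?_) (div_nonneg hM0 (pow_nonneg hη0.le _))) (div_nonneg hM0 (pow_nonneg hη0.le _))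
      rw [le_div_iff₀ (pow_pos hη0 _), mul_comm]
      exact hdir E p
    calc η ^ e6 n * (⨆ E : BallY 𝔸, l2LatSC x.toKIdx O U₀ V (liftY f (E : 𝔸)) hh n) ≤ η ^ e6 n * (M / η ^ e6 n) :=
        mul_le_mul_of_nonneg_left hsup (pow_nonneg hη0.le _)
      _ = M := mul_div_cancel₀ _ (pow_ne_zero _ hη0.ne')

end AugDictionary

/-! ## §3 `KSC₃` — the coded readings of record with the augmented `L²` member — and ★★ the eleven `L²` fields of the frames PROVED for it -/

section KSC3

variable (G : Subgroup 𝔸ˣ) (x : MemberY d ℓ hd hL b₀ b₁ Mstar) (par : SiteParY 𝔸 x.toKIdx)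
  (C37 C38 : ℝ → CfgY 𝔸 x.toKIdx → AfldY 𝔸 x.toKIdx → Prop)

/-- ★ **THE CODED READINGS OF RECORD WITH THE AUGMENTED `L²` MEMBER**: `KSC₂` (gen 8: `KSC` with the (3.47) member silent at products) with the (3.46)
member replaced by `l2AugS` (all sign combinations, letters at the base, operator NODE 00's `G′ = GpY par` at the decoding).
[cite: Balaban1985BackgroundPropagators, Thm 3.1 (3.42)–(3.47) pp.397–398, Thm 3.4 p.400, p.403 l.1–9] -/
def KSC₃ : B9.KernelFamily (geo9Y x) (codingYx G x C37 C38).bg :=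
  { B9SectBCodedChainGlob.KSC₂ G x par C37 C38 with
    l2 := l2AugS x.toKIdx (B := (codingYx G x C37 C38).bg) (fun c => c) (GpY x.toKIdx par) }

omit [FiniteDimensional ℝ 𝔸] in
/-- the (3.42)–(3.45) members of `KSC₃` are `KSC`'s, the (3.47) member is `KSC₂`'s. [cite: Balaban1985BackgroundPropagators, (3.42)–(3.47) pp.397–398, bookkeeping] -/
theorem KSC₃_members :
    (KSC₃ G x par C37 C38).e = (KSC G x par C37 C38).e ∧ (KSC₃ G x par C37 C38).h1 = (KSC G x par C37 C38).h1 ∧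
    (KSC₃ G x par C37 C38).e4 = (KSC G x par C37 C38).e4 ∧ (KSC₃ G x par C37 C38).h2 = (KSC G x par C37 C38).h2 ∧
    (KSC₃ G x par C37 C38).glob = (B9SectBCodedChainGlob.KSC₂ G x par C37 C38).glob := ⟨rfl, rfl, rfl, rfl, rfl⟩

omit [FiniteDimensional ℝ 𝔸] in
/-- the `L²` member of `KSC₃` is the augmented reading of `G′ = GpY par` over the coded configurations. [cite: Balaban1985BackgroundPropagators, (3.46) p.398, bookkeeping] -/
theorem KSC₃_l2 : (KSC₃ G x par C37 C38).l2 = l2AugS x.toKIdx (B := (codingYx G x C37 C38).bg) (fun c => c) (GpY x.toKIdx par) := rfl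

omit [FiniteDimensional ℝ 𝔸] in
/-- at a base the (3.42)–(3.45) and (3.47) blocks of `KSC₃` are `KSC`'s: the `EBlock` of `KSC₃` IS the `EBlock` of `KSC`. [cite: Balaban1985BackgroundPropagators, (3.42) p.397, bookkeeping] -/
theorem eBlock_KSC₃_iff (B₀ δ : ℝ) (c : (codingYx G x C37 C38).bg.Cfg) : EBlock (KSC₃ G x par C37 C38) B₀ δ c ↔ EBlock (KSC G x par C37 C38) B₀ δ c := Iff.rfl

omit [FiniteDimensional ℝ 𝔸] in
/-- the silent global member of `KSC₃` at a product satisfies every (3.47) block with a nonnegative constant (as `KSC₂`'s).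
[cite: Balaban1985BackgroundPropagators, (3.47) p.398, bookkeeping] -/
theorem globBlock_KSC₃_prod (U : CfgY 𝔸 x.toKIdx) (a : AfldY 𝔸 x.toKIdx) {B : ℝ} (hB : 0 ≤ B) : GlobBlock (KSC₃ G x par C37 C38) B (.prod U a) :=
  fun n lam γ _ _ => by
    show (0 : ℝ) ≤ B * (geo9Y x).wNorm γ lam
    exact mul_nonneg hB (B9GeoNormsKLevelV1.geo9K_wNorm_nonneg x.toKIdx γ lam)

variable {ι : Type} [Fintype ι] (b : Module.Basis ι ℝ 𝔸) (ιB : BlkY x.toKIdx → IBondY x.toKIdx) [Fintype (geo9Y x).Site]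

/-- the root frame's (3.42) reading dictionary for `KSC₃` (same (3.42) member as `KSC`). [cite: Balaban1985BackgroundPropagators, (3.42) p.397; Balaban1984PropagatorsII, (2.51) p.232] -/
theorem read342Y_KSC₃ (hι : ∀ s : BlkY x.toKIdx, β x.toKIdx.hN x.toKIdx.D x.toKIdx.hk (ιB s) = s)
    (M₂ : ℝ) (hM₂ : 0 ≤ M₂) (hrepr : ∀ (v : 𝔸) (j : ι), |b.repr v j| ≤ M₂ * ‖v‖) (c35 MInv aInv : ℝ) :
    Read342Y G x par b ιB C37 C38 (KSC₃ G x par C37 C38) c35 (M₂ * ∑ j, ‖b j‖) MInv aInv 0 True :=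
  read342Y_KSC G x par b ιB C37 C38 hι M₂ hM₂ hrepr c35 MInv aInv

omit [FiniteDimensional ℝ 𝔸] in
/-- the root frame's (3.42) writing dictionary for `KSC₃`. [cite: Balaban1985BackgroundPropagators, (3.42) p.397, p.403; Balaban1984PropagatorsII, (2.51) p.232] -/
theorem write342Y_KSC₃ (hι : ∀ s : BlkY x.toKIdx, β x.toKIdx.hN x.toKIdx.D x.toKIdx.hk (ιB s) = s)
    (M₂ : ℝ) (hM₂ : 0 ≤ M₂) (hrepr : ∀ (v : 𝔸) (j : ι), |b.repr v j| ≤ M₂ * ‖v‖) (aW : ℝ) (hC37 : ∀ β' U a, C37 β' U a → GVal G x.toKIdx U) :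
    Write342Y G x par b ιB C37 C38 (KSC₃ G x par C37 C38) (fun B _ => (M₂ * ∑ j, ‖b j‖) * B + 1) (fun δ => δ) aW 0 True :=
  write342Y_KSC G x par b ιB C37 C38 hι M₂ hM₂ hrepr aW hC37

variable [DecidableEq (geo9Y x).Site]

omit [FiniteDimensional ℝ 𝔸] [Fintype ι] [Fintype (geo9Y x).Site] [DecidableEq (geo9Y x).Site] in
/-- at a `G`-valued base the frames' coordinate letter is the genuine box-chart background and the base∕decoding of a product are `(U, e^{ηa}U)`.
[cite: Balaban1985BackgroundPropagators, (3.35) p.396, p.403 l.1–9, bookkeeping] -/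
theorem coordC_base_eq {U : CfgY 𝔸 x.toKIdx} (hU : GVal G x.toKIdx U) : coordC G x.toKIdx (.base U) = UboxY x.toKIdx U := by
  simp only [coordC, if_pos hU]

/-- ★★ **FIELD `L2Frame₂.readL2` AT `KSC₃`** (members 0 and 1): at a `G`-valued base `U`, the (3.46) block of `KSC₃` with `(B₀, δ)` gives the block-`ℓ²`
majorants of `Gop = GopC (base U)` (`c_L·B₀·ℓ(a)²·e^{−δd}`) and of every `conj b (∇♯_k-letter) * Gop` (`c_L·B₀·ℓ(a)·e^{−δd}`).
[cite: Balaban1985BackgroundPropagators, Thm 3.1 (3.46) p.398; Balaban1984PropagatorsII, Prop. 2.6 (2.140) p.247, (2.51) p.232] -/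
theorem readL2_KSC₃ (hι : ∀ s : BlkY x.toKIdx, β x.toKIdx.hN x.toKIdx.D x.toKIdx.hk (ιB s) = s)
    {M₂ : ℝ} (hM₂ : 0 ≤ M₂) (hrepr : ∀ (v : 𝔸) (j : ι), |b.repr v j| ≤ M₂ * ‖v‖) {U : CfgY 𝔸 x.toKIdx} (hU : GVal G x.toKIdx U)
    {B₀ δ : ℝ} (hB₀ : 0 ≤ B₀) (hL2 : L2Block (KSC₃ G x par C37 C38) B₀ δ (.base U)) :
    HasL2Majorant (g := toB6 (geo9Y x) 0 True) (fun p : SiteY x.toKIdx × ι => blkC x.toKIdx ιB p.1) (GopC x.toKIdx par b (.base U))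
        (fun a a' => (Real.sqrt (Fintype.card ι) * M₂ * ∑ j, ‖b j‖) * B₀ * (geo9Y x).len a ^ 2 * Real.exp (-(δ * (geo9Y x).dist a a'))) ∧
      ∀ k : Fin (d + 1) ⊕ Fin (d + 1), HasL2Majorant (g := toB6 (geo9Y x) 0 True) (fun p : SiteY x.toKIdx × ι => blkC x.toKIdx ιB p.1)
        (conj b (diffLetter (shiftY x.toKIdx) (coordC G x.toKIdx (.base U)) ((((geo9Y x).eta : ℂ))⁻¹) k) * GopC x.toKIdx par b (.base U))
        (fun a a' => (Real.sqrt (Fintype.card ι) * M₂ * ∑ j, ‖b j‖) * B₀ * (geo9Y x).len a * Real.exp (-(δ * (geo9Y x).dist a a'))) := by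
  have h := fun n => hasL2Majorant_wordL_of_l2AugS x ιB b hι hM₂ hrepr 0 True (B := (codingYx G x C37 C38).bg) (fun c => c) (GpY x.toKIdx par) hB₀
    (c := .base U) n (fun lam hh y y' hc hs => hL2 n lam hh y y' hc hs)
  rw [coordC_base_eq G x hU]
  refine ⟨B6RandomWalkL2.hasL2Majorant_mono _ (h 0 (Sum.inl 0) (Sum.inl 0)) fun a a' => le_of_eq rfl, fun k => ?_⟩
  rw [show GopC x.toKIdx par b (.base U) = conj b (((kGeo x.toKIdx).eta ^ 2) • (GpY x.toKIdx par U).restrictScalars ℝ) from rfl, ← B9Eq352DivFormLetters.conj_mul]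
  exact B6RandomWalkL2.hasL2Majorant_mono _ (h 1 k k) fun a a' => le_of_eq rfl

/-- ★★ **FIELD `SectBFrame₄.readL2_2` AT `KSC₃`**: `Gop * conj b (∇♯_k-letter) ≺₂ c_L·B₀·ℓ(a)·e^{−δd}`. [cite: Balaban1985BackgroundPropagators, Thm 3.1 (3.46) p.398, p.398 (first remark); Balaban1984PropagatorsII, (2.140) p.247] -/
theorem readL2_two_KSC₃ (hι : ∀ s : BlkY x.toKIdx, β x.toKIdx.hN x.toKIdx.D x.toKIdx.hk (ιB s) = s)
    {M₂ : ℝ} (hM₂ : 0 ≤ M₂) (hrepr : ∀ (v : 𝔸) (j : ι), |b.repr v j| ≤ M₂ * ‖v‖) {U : CfgY 𝔸 x.toKIdx} (hU : GVal G x.toKIdx U)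
    {B₀ δ : ℝ} (hB₀ : 0 ≤ B₀) (hL2 : L2Block (KSC₃ G x par C37 C38) B₀ δ (.base U)) (k : Fin (d + 1) ⊕ Fin (d + 1)) :
    HasL2Majorant (g := toB6 (geo9Y x) 0 True) (fun p : SiteY x.toKIdx × ι => blkC x.toKIdx ιB p.1)
      (GopC x.toKIdx par b (.base U) * conj b (diffLetter (shiftY x.toKIdx) (coordC G x.toKIdx (.base U)) ((((geo9Y x).eta : ℂ))⁻¹) k))
      (fun a a' => (Real.sqrt (Fintype.card ι) * M₂ * ∑ j, ‖b j‖) * B₀ * (geo9Y x).len a * Real.exp (-(δ * (geo9Y x).dist a a'))) := by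
  have h := hasL2Majorant_wordL_of_l2AugS x ιB b hι hM₂ hrepr 0 True (B := (codingYx G x C37 C38).bg) (fun c => c) (GpY x.toKIdx par) hB₀
    (c := .base U) 2 (fun lam hh y y' hc hs => hL2 2 lam hh y y' hc hs) k k
  rw [coordC_base_eq G x hU, show GopC x.toKIdx par b (.base U) = conj b (((kGeo x.toKIdx).eta ^ 2) • (GpY x.toKIdx par U).restrictScalars ℝ) from rfl,
    ← B9Eq352DivFormLetters.conj_mul]
  exact B6RandomWalkL2.hasL2Majorant_mono _ h fun a a' => le_of_eq rfl

/-- ★★ **FIELD `SectBFrame₄.readL2_3` AT `KSC₃`**: `conj b (∇♯_k) * conj b (∇♯_l) * Gop ≺₂ c_L·B₀·1·e^{−δd}`. [cite: Balaban1985BackgroundPropagators, Thm 3.1 (3.46) p.398, p.398 (first remark); Balaban1984PropagatorsII, (2.140) p.247] -/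
theorem readL2_three_KSC₃ (hι : ∀ s : BlkY x.toKIdx, β x.toKIdx.hN x.toKIdx.D x.toKIdx.hk (ιB s) = s)
    {M₂ : ℝ} (hM₂ : 0 ≤ M₂) (hrepr : ∀ (v : 𝔸) (j : ι), |b.repr v j| ≤ M₂ * ‖v‖) {U : CfgY 𝔸 x.toKIdx} (hU : GVal G x.toKIdx U)
    {B₀ δ : ℝ} (hB₀ : 0 ≤ B₀) (hL2 : L2Block (KSC₃ G x par C37 C38) B₀ δ (.base U)) (k l : Fin (d + 1) ⊕ Fin (d + 1)) :
    HasL2Majorant (g := toB6 (geo9Y x) 0 True) (fun p : SiteY x.toKIdx × ι => blkC x.toKIdx ιB p.1)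
      (conj b (diffLetter (shiftY x.toKIdx) (coordC G x.toKIdx (.base U)) ((((geo9Y x).eta : ℂ))⁻¹) k) *
        conj b (diffLetter (shiftY x.toKIdx) (coordC G x.toKIdx (.base U)) ((((geo9Y x).eta : ℂ))⁻¹) l) * GopC x.toKIdx par b (.base U))
      (fun a a' => (Real.sqrt (Fintype.card ι) * M₂ * ∑ j, ‖b j‖) * B₀ * 1 * Real.exp (-(δ * (geo9Y x).dist a a'))) := by
  have h := hasL2Majorant_wordL_of_l2AugS x ιB b hι hM₂ hrepr 0 True (B := (codingYx G x C37 C38).bg) (fun c => c) (GpY x.toKIdx par) hB₀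
    (c := .base U) 3 (fun lam hh y y' hc hs => hL2 3 lam hh y y' hc hs) k l
  rw [coordC_base_eq G x hU, show GopC x.toKIdx par b (.base U) = conj b (((kGeo x.toKIdx).eta ^ 2) • (GpY x.toKIdx par U).restrictScalars ℝ) from rfl,
    ← B9Eq352DivFormLetters.conj_mul, ← B9Eq352DivFormLetters.conj_mul]
  exact B6RandomWalkL2.hasL2Majorant_mono _ h fun a a' => le_of_eq rfl

/-- ★★ **FIELD `SectBFrame₄.readL2_4` AT `KSC₃`** (the mixed member): `conj b (∇♯_k) * Gop * conj b (∇♯_l) ≺₂ c_L·B₀·1·e^{−δd}`. [cite: Balaban1985BackgroundPropagators, Thm 3.1 (3.46) p.398, p.398 (first remark); Balaban1984PropagatorsII, (2.140) p.247] -/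
theorem readL2_four_KSC₃ (hι : ∀ s : BlkY x.toKIdx, β x.toKIdx.hN x.toKIdx.D x.toKIdx.hk (ιB s) = s)
    {M₂ : ℝ} (hM₂ : 0 ≤ M₂) (hrepr : ∀ (v : 𝔸) (j : ι), |b.repr v j| ≤ M₂ * ‖v‖) {U : CfgY 𝔸 x.toKIdx} (hU : GVal G x.toKIdx U)
    {B₀ δ : ℝ} (hB₀ : 0 ≤ B₀) (hL2 : L2Block (KSC₃ G x par C37 C38) B₀ δ (.base U)) (k l : Fin (d + 1) ⊕ Fin (d + 1)) :
    HasL2Majorant (g := toB6 (geo9Y x) 0 True) (fun p : SiteY x.toKIdx × ι => blkC x.toKIdx ιB p.1)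
      (conj b (diffLetter (shiftY x.toKIdx) (coordC G x.toKIdx (.base U)) ((((geo9Y x).eta : ℂ))⁻¹) k) * GopC x.toKIdx par b (.base U) *
        conj b (diffLetter (shiftY x.toKIdx) (coordC G x.toKIdx (.base U)) ((((geo9Y x).eta : ℂ))⁻¹) l))
      (fun a a' => (Real.sqrt (Fintype.card ι) * M₂ * ∑ j, ‖b j‖) * B₀ * 1 * Real.exp (-(δ * (geo9Y x).dist a a'))) := by
  have h := hasL2Majorant_wordL_of_l2AugS x ιB b hι hM₂ hrepr 0 True (B := (codingYx G x C37 C38).bg) (fun c => c) (GpY x.toKIdx par) hB₀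
    (c := .base U) 4 (fun lam hh y y' hc hs => hL2 4 lam hh y y' hc hs) k l
  rw [coordC_base_eq G x hU, show GopC x.toKIdx par b (.base U) = conj b (((kGeo x.toKIdx).eta ^ 2) • (GpY x.toKIdx par U).restrictScalars ℝ) from rfl,
    ← B9Eq352DivFormLetters.conj_mul, ← B9Eq352DivFormLetters.conj_mul]
  exact B6RandomWalkL2.hasL2Majorant_mono _ h fun a a' => le_of_eq rfl

/-- ★★ **FIELD `SectBFrame₄.readL2_5` AT `KSC₃`**: `Gop * conj b (∇♯_k) * conj b (∇♯_l) ≺₂ c_L·B₀·1·e^{−δd}`. [cite: Balaban1985BackgroundPropagators, Thm 3.1 (3.46) p.398, p.398 (first remark); Balaban1984PropagatorsII, (2.140) p.247] -/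
theorem readL2_five_KSC₃ (hι : ∀ s : BlkY x.toKIdx, β x.toKIdx.hN x.toKIdx.D x.toKIdx.hk (ιB s) = s)
    {M₂ : ℝ} (hM₂ : 0 ≤ M₂) (hrepr : ∀ (v : 𝔸) (j : ι), |b.repr v j| ≤ M₂ * ‖v‖) {U : CfgY 𝔸 x.toKIdx} (hU : GVal G x.toKIdx U)
    {B₀ δ : ℝ} (hB₀ : 0 ≤ B₀) (hL2 : L2Block (KSC₃ G x par C37 C38) B₀ δ (.base U)) (k l : Fin (d + 1) ⊕ Fin (d + 1)) :
    HasL2Majorant (g := toB6 (geo9Y x) 0 True) (fun p : SiteY x.toKIdx × ι => blkC x.toKIdx ιB p.1)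
      (GopC x.toKIdx par b (.base U) * conj b (diffLetter (shiftY x.toKIdx) (coordC G x.toKIdx (.base U)) ((((geo9Y x).eta : ℂ))⁻¹) k) *
        conj b (diffLetter (shiftY x.toKIdx) (coordC G x.toKIdx (.base U)) ((((geo9Y x).eta : ℂ))⁻¹) l))
      (fun a a' => (Real.sqrt (Fintype.card ι) * M₂ * ∑ j, ‖b j‖) * B₀ * 1 * Real.exp (-(δ * (geo9Y x).dist a a'))) := by
  have h := hasL2Majorant_wordL_of_l2AugS x ιB b hι hM₂ hrepr 0 True (B := (codingYx G x C37 C38).bg) (fun c => c) (GpY x.toKIdx par) hB₀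
    (c := .base U) 5 (fun lam hh y y' hc hs => hL2 5 lam hh y y' hc hs) k l
  rw [coordC_base_eq G x hU, show GopC x.toKIdx par b (.base U) = conj b (((kGeo x.toKIdx).eta ^ 2) • (GpY x.toKIdx par U).restrictScalars ℝ) from rfl,
    ← B9Eq352DivFormLetters.conj_mul, ← B9Eq352DivFormLetters.conj_mul]
  exact B6RandomWalkL2.hasL2Majorant_mono _ h fun a a' => le_of_eq rfl

omit [FiniteDimensional ℝ 𝔸] in
/-- the weakening `c_L·B ↦ c_L·B + 1` of a (3.46) member bound (the frames' writing function must be positive at `B = 0`).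
[cite: Balaban1985BackgroundPropagators, (3.46) p.398, bookkeeping] -/
theorem member_bound_weaken {A A' p cs ex nl v : ℝ} (hA : A ≤ A') (hp : 0 ≤ p) (hcs : 0 ≤ cs) (hex : 0 ≤ ex) (hnl : 0 ≤ nl)
    (hv : v ≤ A * p * cs * ex * nl) : v ≤ A' * p * cs * ex * nl :=
  hv.trans (by gcongr)

omit [FiniteDimensional ℝ 𝔸] in
/-- ★★ **FIELDS `writeL2_0 … writeL2_5` AT `KSC₃`, ALL SIX AT ONCE**: at a coded product `prod U a` over a `G`-valued base `U`, block-`ℓ²` majorants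
`B·pref6_n(ℓ(a))·e^{−δd}` (`B ≧ 0`) of all the composites `conj b (wordL_n(k,l))` — letters at the base `U`, operator `G′(e^{ηa}U)` — give member `n` of `KSC₃` at
the product with `((c_L·B + 1), δ)`. [cite: Balaban1985BackgroundPropagators, Thm 3.1 (3.46) p.398, Thm 3.4 p.400, p.403 («of course with different constants»); Balaban1984PropagatorsII, Prop. 2.6 (2.140) p.247] -/
theorem writeL2_KSC₃ (hι : ∀ s : BlkY x.toKIdx, β x.toKIdx.hN x.toKIdx.D x.toKIdx.hk (ιB s) = s)
    {M₂ : ℝ} (hM₂ : 0 ≤ M₂) (hrepr : ∀ (v : 𝔸) (j : ι), |b.repr v j| ≤ M₂ * ‖v‖) (U : CfgY 𝔸 x.toKIdx) (a : AfldY 𝔸 x.toKIdx)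
    {B δ : ℝ} (hB : 0 ≤ B) (n : Fin 6)
    (hW : ∀ k l : Fin (d + 1) ⊕ Fin (d + 1), HasL2Majorant (g := toB6 (geo9Y x) 0 True) (fun p : SiteY x.toKIdx × ι => blkC x.toKIdx ιB p.1)
      (conj b (wordL x.toKIdx (GpY x.toKIdx par) U (mulY x.toKIdx (fluct (kGeo x.toKIdx).eta a) U) (kGeo x.toKIdx).eta n k l))
      (fun a a' => B * B9.pref6 ((geo9Y x).len a) n * Real.exp (-(δ * (geo9Y x).dist a a'))))
    (lam : (geo9Y x).Loc) (h : (geo9Y x).Cut) (y y' : IBondY x.toKIdx) (hcut : (geo9Y x).cutIn h y) (hsupp : (geo9Y x).suppIn lam y') :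
    (KSC₃ G x par C37 C38).l2 n (.prod U a) lam h ≤ ((Real.sqrt (Fintype.card ι) * M₂ * ∑ j, ‖b j‖) * B + 1) * B9.pref6 ((geo9Y x).len y) n *
      (geo9Y x).cutSup h * Real.exp (-(δ * (geo9Y x).dist y y')) * (geo9Y x).l2Norm lam := by
  have hmain := l2AugS_le_of_hasL2Majorant_wordL x ιB b hι hM₂ hrepr 0 True (B := (codingYx G x C37 C38).bg) (fun c => c) (GpY x.toKIdx par) hB
    (c := .prod U a) n hW lam h y y' hcut hsupp
  exact member_bound_weaken (by linarith) (pref6_nonneg (geo9Y_len_pos x y).le n) (B9GeoNormsKLevelV1.geo9K_cutSup_nonneg x.toKIdx h)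
    (Real.exp_pos _).le (B9GeoNormsKLevelV1.geo9K_l2Norm_nonneg x.toKIdx lam) hmain

omit [FiniteDimensional ℝ 𝔸] in
/-- ★★ **FIELD `L2Frame₂.writeL2_0` AT `KSC₃`** in the frame's literal shape (majorant of `Gop (prod U a)`).
[cite: Balaban1985BackgroundPropagators, Thm 3.1 (3.46) p.398, Thm 3.4 p.400, p.403 l.1–9; Balaban1984PropagatorsII, (2.140) p.247] -/
theorem writeL2_zero_KSC₃ (hι : ∀ s : BlkY x.toKIdx, β x.toKIdx.hN x.toKIdx.D x.toKIdx.hk (ιB s) = s)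
    {M₂ : ℝ} (hM₂ : 0 ≤ M₂) (hrepr : ∀ (v : 𝔸) (j : ι), |b.repr v j| ≤ M₂ * ‖v‖) (U : CfgY 𝔸 x.toKIdx) (a : AfldY 𝔸 x.toKIdx) {B δ : ℝ} (hB : 0 ≤ B)
    (hG : HasL2Majorant (g := toB6 (geo9Y x) 0 True) (fun p : SiteY x.toKIdx × ι => blkC x.toKIdx ιB p.1) (GopC x.toKIdx par b (.prod U a))
      (fun a a' => B * (geo9Y x).len a ^ 2 * Real.exp (-(δ * (geo9Y x).dist a a'))))
    (lam : (geo9Y x).Loc) (h : (geo9Y x).Cut) (y y' : IBondY x.toKIdx) (hcut : (geo9Y x).cutIn h y) (hsupp : (geo9Y x).suppIn lam y') :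
    (KSC₃ G x par C37 C38).l2 0 (.prod U a) lam h ≤ ((Real.sqrt (Fintype.card ι) * M₂ * ∑ j, ‖b j‖) * B + 1) * B9.pref6 ((geo9Y x).len y) 0 *
      (geo9Y x).cutSup h * Real.exp (-(δ * (geo9Y x).dist y y')) * (geo9Y x).l2Norm lam :=
  writeL2_KSC₃ G x par C37 C38 b ιB hι hM₂ hrepr U a hB 0 (fun _ _ => B6RandomWalkL2.hasL2Majorant_mono _ hG fun _ _ => le_of_eq rfl) lam h y y' hcut hsupp

omit [FiniteDimensional ℝ 𝔸] in
/-- ★★ **FIELD `L2Frame₂.writeL2_1` AT `KSC₃`** (majorants of every `conj b (∇♯_k at the base) * Gop (prod U a)`).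
[cite: Balaban1985BackgroundPropagators, Thm 3.1 (3.46) p.398, Thm 3.4 p.400, p.403 l.1–9; Balaban1984PropagatorsII, (2.140) p.247] -/
theorem writeL2_one_KSC₃ (hι : ∀ s : BlkY x.toKIdx, β x.toKIdx.hN x.toKIdx.D x.toKIdx.hk (ιB s) = s)
    {M₂ : ℝ} (hM₂ : 0 ≤ M₂) (hrepr : ∀ (v : 𝔸) (j : ι), |b.repr v j| ≤ M₂ * ‖v‖) {U : CfgY 𝔸 x.toKIdx} (hU : GVal G x.toKIdx U) (a : AfldY 𝔸 x.toKIdx)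
    {B δ : ℝ} (hB : 0 ≤ B)
    (hDG : ∀ k : Fin (d + 1) ⊕ Fin (d + 1), HasL2Majorant (g := toB6 (geo9Y x) 0 True) (fun p : SiteY x.toKIdx × ι => blkC x.toKIdx ιB p.1)
      (conj b (diffLetter (shiftY x.toKIdx) (coordC G x.toKIdx (.base U)) ((((geo9Y x).eta : ℂ))⁻¹) k) * GopC x.toKIdx par b (.prod U a))
      (fun a a' => B * (geo9Y x).len a * Real.exp (-(δ * (geo9Y x).dist a a'))))
    (lam : (geo9Y x).Loc) (h : (geo9Y x).Cut) (y y' : IBondY x.toKIdx) (hcut : (geo9Y x).cutIn h y) (hsupp : (geo9Y x).suppIn lam y') :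
    (KSC₃ G x par C37 C38).l2 1 (.prod U a) lam h ≤ ((Real.sqrt (Fintype.card ι) * M₂ * ∑ j, ‖b j‖) * B + 1) * B9.pref6 ((geo9Y x).len y) 1 *
      (geo9Y x).cutSup h * Real.exp (-(δ * (geo9Y x).dist y y')) * (geo9Y x).l2Norm lam := by
  refine writeL2_KSC₃ G x par C37 C38 b ιB hι hM₂ hrepr U a hB 1 (fun k _ => ?_) lam h y y' hcut hsupp
  have h := hDG k
  rw [coordC_base_eq G x hU, show GopC x.toKIdx par b (.prod U a) =
    conj b (((kGeo x.toKIdx).eta ^ 2) • (GpY x.toKIdx par (mulY x.toKIdx (fluct (kGeo x.toKIdx).eta a) U)).restrictScalars ℝ) from rfl, ← B9Eq352DivFormLetters.conj_mul] at h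
  exact B6RandomWalkL2.hasL2Majorant_mono _ h fun a a' => le_of_eq rfl

omit [FiniteDimensional ℝ 𝔸] in
/-- ★★ **FIELD `SectBFrame₄.writeL2_2` AT `KSC₃`** (majorants of every `Gop (prod U a) * conj b (∇♯_k at the base)`).
[cite: Balaban1985BackgroundPropagators, Thm 3.1 (3.46) p.398, Thm 3.4 p.400, p.403 l.1–9; Balaban1984PropagatorsII, (2.140) p.247] -/
theorem writeL2_two_KSC₃ (hι : ∀ s : BlkY x.toKIdx, β x.toKIdx.hN x.toKIdx.D x.toKIdx.hk (ιB s) = s)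
    {M₂ : ℝ} (hM₂ : 0 ≤ M₂) (hrepr : ∀ (v : 𝔸) (j : ι), |b.repr v j| ≤ M₂ * ‖v‖) {U : CfgY 𝔸 x.toKIdx} (hU : GVal G x.toKIdx U) (a : AfldY 𝔸 x.toKIdx)
    {B δ : ℝ} (hB : 0 ≤ B)
    (hGD : ∀ k : Fin (d + 1) ⊕ Fin (d + 1), HasL2Majorant (g := toB6 (geo9Y x) 0 True) (fun p : SiteY x.toKIdx × ι => blkC x.toKIdx ιB p.1)
      (GopC x.toKIdx par b (.prod U a) * conj b (diffLetter (shiftY x.toKIdx) (coordC G x.toKIdx (.base U)) ((((geo9Y x).eta : ℂ))⁻¹) k))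
      (fun a a' => B * (geo9Y x).len a * Real.exp (-(δ * (geo9Y x).dist a a'))))
    (lam : (geo9Y x).Loc) (h : (geo9Y x).Cut) (y y' : IBondY x.toKIdx) (hcut : (geo9Y x).cutIn h y) (hsupp : (geo9Y x).suppIn lam y') :
    (KSC₃ G x par C37 C38).l2 2 (.prod U a) lam h ≤ ((Real.sqrt (Fintype.card ι) * M₂ * ∑ j, ‖b j‖) * B + 1) * B9.pref6 ((geo9Y x).len y) 2 *
      (geo9Y x).cutSup h * Real.exp (-(δ * (geo9Y x).dist y y')) * (geo9Y x).l2Norm lam := by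
  refine writeL2_KSC₃ G x par C37 C38 b ιB hι hM₂ hrepr U a hB 2 (fun k _ => ?_) lam h y y' hcut hsupp
  have h := hGD k
  rw [coordC_base_eq G x hU, show GopC x.toKIdx par b (.prod U a) =
    conj b (((kGeo x.toKIdx).eta ^ 2) • (GpY x.toKIdx par (mulY x.toKIdx (fluct (kGeo x.toKIdx).eta a) U)).restrictScalars ℝ) from rfl, ← B9Eq352DivFormLetters.conj_mul] at h
  exact B6RandomWalkL2.hasL2Majorant_mono _ h fun a a' => le_of_eq rfl

omit [FiniteDimensional ℝ 𝔸] in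
/-- ★★ **FIELD `SectBFrame₄.writeL2_3` AT `KSC₃`** (majorants of every `conj b (∇♯_k) * conj b (∇♯_l) * Gop (prod U a)`).
[cite: Balaban1985BackgroundPropagators, Thm 3.1 (3.46) p.398, Thm 3.4 p.400, p.403 l.1–9; Balaban1984PropagatorsII, (2.140) p.247] -/
theorem writeL2_three_KSC₃ (hι : ∀ s : BlkY x.toKIdx, β x.toKIdx.hN x.toKIdx.D x.toKIdx.hk (ιB s) = s)
    {M₂ : ℝ} (hM₂ : 0 ≤ M₂) (hrepr : ∀ (v : 𝔸) (j : ι), |b.repr v j| ≤ M₂ * ‖v‖) {U : CfgY 𝔸 x.toKIdx} (hU : GVal G x.toKIdx U) (a : AfldY 𝔸 x.toKIdx)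
    {B δ : ℝ} (hB : 0 ≤ B)
    (hDDG : ∀ k l : Fin (d + 1) ⊕ Fin (d + 1), HasL2Majorant (g := toB6 (geo9Y x) 0 True) (fun p : SiteY x.toKIdx × ι => blkC x.toKIdx ιB p.1)
      (conj b (diffLetter (shiftY x.toKIdx) (coordC G x.toKIdx (.base U)) ((((geo9Y x).eta : ℂ))⁻¹) k) *
        conj b (diffLetter (shiftY x.toKIdx) (coordC G x.toKIdx (.base U)) ((((geo9Y x).eta : ℂ))⁻¹) l) * GopC x.toKIdx par b (.prod U a))
      (fun a a' => B * 1 * Real.exp (-(δ * (geo9Y x).dist a a'))))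
    (lam : (geo9Y x).Loc) (h : (geo9Y x).Cut) (y y' : IBondY x.toKIdx) (hcut : (geo9Y x).cutIn h y) (hsupp : (geo9Y x).suppIn lam y') :
    (KSC₃ G x par C37 C38).l2 3 (.prod U a) lam h ≤ ((Real.sqrt (Fintype.card ι) * M₂ * ∑ j, ‖b j‖) * B + 1) * B9.pref6 ((geo9Y x).len y) 3 *
      (geo9Y x).cutSup h * Real.exp (-(δ * (geo9Y x).dist y y')) * (geo9Y x).l2Norm lam := by
  refine writeL2_KSC₃ G x par C37 C38 b ιB hι hM₂ hrepr U a hB 3 (fun k l => ?_) lam h y y' hcut hsupp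
  have h := hDDG k l
  rw [coordC_base_eq G x hU, show GopC x.toKIdx par b (.prod U a) =
    conj b (((kGeo x.toKIdx).eta ^ 2) • (GpY x.toKIdx par (mulY x.toKIdx (fluct (kGeo x.toKIdx).eta a) U)).restrictScalars ℝ) from rfl,
    ← B9Eq352DivFormLetters.conj_mul, ← B9Eq352DivFormLetters.conj_mul] at h
  exact B6RandomWalkL2.hasL2Majorant_mono _ h fun a a' => le_of_eq rfl

omit [FiniteDimensional ℝ 𝔸] in
/-- ★★ **FIELD `SectBFrame₄.writeL2_4` AT `KSC₃`** (the mixed member: majorants of every `conj b (∇♯_k) * Gop (prod U a) * conj b (∇♯_l)`).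
[cite: Balaban1985BackgroundPropagators, Thm 3.1 (3.46) p.398, Thm 3.4 p.400, p.403 l.1–9; Balaban1984PropagatorsII, (2.140) p.247] -/
theorem writeL2_four_KSC₃ (hι : ∀ s : BlkY x.toKIdx, β x.toKIdx.hN x.toKIdx.D x.toKIdx.hk (ιB s) = s)
    {M₂ : ℝ} (hM₂ : 0 ≤ M₂) (hrepr : ∀ (v : 𝔸) (j : ι), |b.repr v j| ≤ M₂ * ‖v‖) {U : CfgY 𝔸 x.toKIdx} (hU : GVal G x.toKIdx U) (a : AfldY 𝔸 x.toKIdx)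
    {B δ : ℝ} (hB : 0 ≤ B)
    (hDGD : ∀ k l : Fin (d + 1) ⊕ Fin (d + 1), HasL2Majorant (g := toB6 (geo9Y x) 0 True) (fun p : SiteY x.toKIdx × ι => blkC x.toKIdx ιB p.1)
      (conj b (diffLetter (shiftY x.toKIdx) (coordC G x.toKIdx (.base U)) ((((geo9Y x).eta : ℂ))⁻¹) k) * GopC x.toKIdx par b (.prod U a) *
        conj b (diffLetter (shiftY x.toKIdx) (coordC G x.toKIdx (.base U)) ((((geo9Y x).eta : ℂ))⁻¹) l))
      (fun a a' => B * 1 * Real.exp (-(δ * (geo9Y x).dist a a'))))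
    (lam : (geo9Y x).Loc) (h : (geo9Y x).Cut) (y y' : IBondY x.toKIdx) (hcut : (geo9Y x).cutIn h y) (hsupp : (geo9Y x).suppIn lam y') :
    (KSC₃ G x par C37 C38).l2 4 (.prod U a) lam h ≤ ((Real.sqrt (Fintype.card ι) * M₂ * ∑ j, ‖b j‖) * B + 1) * B9.pref6 ((geo9Y x).len y) 4 *
      (geo9Y x).cutSup h * Real.exp (-(δ * (geo9Y x).dist y y')) * (geo9Y x).l2Norm lam := by
  refine writeL2_KSC₃ G x par C37 C38 b ιB hι hM₂ hrepr U a hB 4 (fun k l => ?_) lam h y y' hcut hsupp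
  have h := hDGD k l
  rw [coordC_base_eq G x hU, show GopC x.toKIdx par b (.prod U a) =
    conj b (((kGeo x.toKIdx).eta ^ 2) • (GpY x.toKIdx par (mulY x.toKIdx (fluct (kGeo x.toKIdx).eta a) U)).restrictScalars ℝ) from rfl,
    ← B9Eq352DivFormLetters.conj_mul, ← B9Eq352DivFormLetters.conj_mul] at h
  exact B6RandomWalkL2.hasL2Majorant_mono _ h fun a a' => le_of_eq rfl

omit [FiniteDimensional ℝ 𝔸] in
/-- ★★ **FIELD `SectBFrame₄.writeL2_5` AT `KSC₃`** (majorants of every `Gop (prod U a) * conj b (∇♯_k) * conj b (∇♯_l)`).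
[cite: Balaban1985BackgroundPropagators, Thm 3.1 (3.46) p.398, Thm 3.4 p.400, p.403 l.1–9; Balaban1984PropagatorsII, (2.140) p.247] -/
theorem writeL2_five_KSC₃ (hι : ∀ s : BlkY x.toKIdx, β x.toKIdx.hN x.toKIdx.D x.toKIdx.hk (ιB s) = s)
    {M₂ : ℝ} (hM₂ : 0 ≤ M₂) (hrepr : ∀ (v : 𝔸) (j : ι), |b.repr v j| ≤ M₂ * ‖v‖) {U : CfgY 𝔸 x.toKIdx} (hU : GVal G x.toKIdx U) (a : AfldY 𝔸 x.toKIdx)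
    {B δ : ℝ} (hB : 0 ≤ B)
    (hGDD : ∀ k l : Fin (d + 1) ⊕ Fin (d + 1), HasL2Majorant (g := toB6 (geo9Y x) 0 True) (fun p : SiteY x.toKIdx × ι => blkC x.toKIdx ιB p.1)
      (GopC x.toKIdx par b (.prod U a) * conj b (diffLetter (shiftY x.toKIdx) (coordC G x.toKIdx (.base U)) ((((geo9Y x).eta : ℂ))⁻¹) k) *
        conj b (diffLetter (shiftY x.toKIdx) (coordC G x.toKIdx (.base U)) ((((geo9Y x).eta : ℂ))⁻¹) l))
      (fun a a' => B * 1 * Real.exp (-(δ * (geo9Y x).dist a a'))))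
    (lam : (geo9Y x).Loc) (h : (geo9Y x).Cut) (y y' : IBondY x.toKIdx) (hcut : (geo9Y x).cutIn h y) (hsupp : (geo9Y x).suppIn lam y') :
    (KSC₃ G x par C37 C38).l2 5 (.prod U a) lam h ≤ ((Real.sqrt (Fintype.card ι) * M₂ * ∑ j, ‖b j‖) * B + 1) * B9.pref6 ((geo9Y x).len y) 5 *
      (geo9Y x).cutSup h * Real.exp (-(δ * (geo9Y x).dist y y')) * (geo9Y x).l2Norm lam := by
  refine writeL2_KSC₃ G x par C37 C38 b ιB hι hM₂ hrepr U a hB 5 (fun k l => ?_) lam h y y' hcut hsupp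
  have h := hGDD k l
  rw [coordC_base_eq G x hU, show GopC x.toKIdx par b (.prod U a) =
    conj b (((kGeo x.toKIdx).eta ^ 2) • (GpY x.toKIdx par (mulY x.toKIdx (fluct (kGeo x.toKIdx).eta a) U)).restrictScalars ℝ) from rfl,
    ← B9Eq352DivFormLetters.conj_mul, ← B9Eq352DivFormLetters.conj_mul] at h
  exact B6RandomWalkL2.hasL2Majorant_mono _ h fun a a' => le_of_eq rfl

end KSC3

/-! ## §4 ★★ The `L²` frame `L2Frame₂` over the coded carriers of a subfamily, INHABITED at `KSC₃` (and the (3.47) frame re-instantiated at `KSC₃`) -/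

section Frames

variable [NormOneClass 𝔸] {J : Type} (f : J → MemberY d ℓ hd hL b₀ b₁ Mstar)
  (c35 : ℝ) (G : Subgroup 𝔸ˣ) {ι : Type} [Fintype ι] [DecidableEq ι] (b : Module.Basis ι ℝ 𝔸)
  [∀ x : MemberY d ℓ hd hL b₀ b₁ Mstar, Fintype (geo9Y x).Site] [instDS : ∀ x : MemberY d ℓ hd hL b₀ b₁ Mstar, DecidableEq (geo9Y x).Site]
  [∀ x : MemberY d ℓ hd hL b₀ b₁ Mstar, Nonempty (geo9Y x).Site]
  (C37 C38 : ∀ j : J, ℝ → CfgY 𝔸 (f j).toKIdx → AfldY 𝔸 (f j).toKIdx → Prop)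
  (par : ∀ j : J, SiteParY 𝔸 (f j).toKIdx)
  (ιB : ∀ j : J, BlkY (f j).toKIdx → IBondY (f j).toKIdx)

/-- ★★ **THE `L²` FRAME `L2Frame₂` OVER THE CODED CARRIERS OF A SUBFAMILY, INHABITED** at the readings `KSC₃`: gen 8's root frame `gpFrame₂CodedOn` at `KC := KSC₃`
(dictionaries `read342Y_KSC₃` ∕ `write342Y_KSC₃`, reading constant `c_R = M₂Σ‖b_j‖`, writing functions `(c_R·B + 1, δ)`) extended by the `L²` reading constant
`c_L = √|ι|·M₂·Σ_j‖b_j‖`, the writing functions `(c_L·B + 1, δ)`, and the fields `readL2` ∕ `writeL2_0` ∕ `writeL2_1` DISCHARGED by §3 — threshold-free, as the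
(O4) architecture requires.  The six further `L²` fields of `SectBFrame₄` are §3's `readL2_two … writeL2_five_KSC₃` in their literal shapes.
[cite: Balaban1985BackgroundPropagators, Thm 3.4 p.400, Thm 3.1 (3.46) p.398, (3.42) p.397, p.403 l.1–9; Balaban1984PropagatorsII, Prop. 2.6 (2.140) p.247, Lemma 2.1 p.234, (2.51) p.232] -/
noncomputable def l2Frame₂CodedOn (hι : ∀ (j : J) (s : BlkY (f j).toKIdx), β (f j).toKIdx.hN (f j).toKIdx.D (f j).toKIdx.hk (ιB j s) = s)
    (hG1 : ∀ u : 𝔸ˣ, u ∈ G → ‖(u : 𝔸)‖ ≤ 1) (hpar : ∀ j (U : CfgY 𝔸 (f j).toKIdx), GVal G (f j).toKIdx U → ∀ z w, par j U z w ∈ G)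
    (hunit : ∀ j (U : CfgY 𝔸 (f j).toKIdx), GVal G (f j).toKIdx U → IsUnit (Node00.deltaPrimeAY (f j).toKIdx (par j) U))
    (dB : ℕ) (M₂ : ℝ) (hM₂ : 0 ≤ M₂) (hrepr : ∀ (v : 𝔸) (j : ι), |b.repr v j| ≤ M₂ * ‖v‖) (hcR : 0 < M₂ * ∑ j, ‖b j‖)
    (hcL : 0 < Real.sqrt (Fintype.card ι) * M₂ * ∑ j, ‖b j‖)
    (Cq : ℝ) (hCq : 0 ≤ Cq) (hC37 : ∀ j β' U a, C37 j β' U a → GVal G (f j).toKIdx U ∧ CplxLettersY G (f j) (par j) (ιB j) Cq β' U a)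
    (MInv aInv aW : ℝ) (hMInv : 0 < MInv) (haInv : 0 < aInv) (haW : 0 < aW) :
    B9SectBL2StepAtLettersV2.L2Frame₂ c35 (fun j => geo9Y (f j)) (fun j => (codingYx G (f j) (C37 j) (C38 j)).bg)
      (fun j => KSC₃ G (f j) (par j) (C37 j) (C38 j)) b (Fin (d + 1)) (fun j => SiteY (f j).toKIdx) :=
  { B9SectBCodedChainOnSubfamily.gpFrame₂CodedOn f c35 G b C37 C38 par ιB (fun j => KSC₃ G (f j) (par j) (C37 j) (C38 j)) hι hG1 hpar hunit dB M₂ hM₂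
      hrepr Cq hCq hC37 (M₂ * ∑ j, ‖b j‖) hcR (fun B _ => (M₂ * ∑ j, ‖b j‖) * B + 1) (fun B _ hB _ => by positivity) (fun δ => δ) (fun δ hδ => hδ)
      MInv aInv aW hMInv haInv haW (fun j => read342Y_KSC₃ G (f j) (par j) (C37 j) (C38 j) b (ιB j) (hι j) M₂ hM₂ hrepr c35 MInv aInv)
      (fun j => write342Y_KSC₃ G (f j) (par j) (C37 j) (C38 j) b (ιB j) (hι j) M₂ hM₂ hrepr aW fun β' U a h => (hC37 j β' U a h).1) with
    cL := Real.sqrt (Fintype.card ι) * M₂ * ∑ j, ‖b j‖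
    wL := fun B _ => (Real.sqrt (Fintype.card ι) * M₂ * ∑ j, ‖b j‖) * B + 1
    wLδ := fun δ => δ
    cL_pos := hcL
    wL_pos := fun B _ hB _ => by positivity
    wLδ_pos := fun δ hδ => hδ
    readL2 := fun j α₀ c B₀ δ _ _ _ hreg hB₀ _ hL2 => by
      obtain ⟨U, rfl, hU⟩ := (codingYx G (f j) (C37 j) (C38 j)).exists_of_bg_Reg335 hreg
      exact readL2_KSC₃ G (f j) (par j) (C37 j) (C38 j) b (ιB j) (hι j) hM₂ hrepr hU.1.1 hB₀.le hL2
    writeL2_0 := fun j c c' α₁ B δ _ _ h37 hB _ hG lam h y y' hc hs => by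
      obtain ⟨U, a, rfl, rfl, hC⟩ := (codingYx G (f j) (C37 j) (C38 j)).exists_of_bg_Cplx337 h37
      exact writeL2_zero_KSC₃ G (f j) (par j) (C37 j) (C38 j) b (ιB j) (hι j) hM₂ hrepr U a hB hG lam h y y' hc hs
    writeL2_1 := fun j c c' α₁ B δ _ _ h37 hB _ hDG lam h y y' hc hs => by
      obtain ⟨U, a, rfl, rfl, hC⟩ := (codingYx G (f j) (C37 j) (C38 j)).exists_of_bg_Cplx337 h37
      exact writeL2_one_KSC₃ G (f j) (par j) (C37 j) (C38 j) b (ιB j) (hι j) hM₂ hrepr (hC37 j _ U a hC).1 a hB hDG lam h y y' hc hs }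

/-- ★ **THE (3.47) FRAME OVER THE CODED CARRIERS OF A SUBFAMILY AT `KSC₃`** (as gen 8's `globFrame₂CodedOn` at `KSC₂`: the global member of `KSC₃` is `KSC₂`'s,
silent at products). [cite: Balaban1985BackgroundPropagators, Thm 3.4 p.400, (3.47) p.398, (3.42) p.397; Balaban1984PropagatorsII, Lemma 2.1 p.234, (2.51) p.232] -/
noncomputable def globFrame₂CodedOn₃ (hι : ∀ (j : J) (s : BlkY (f j).toKIdx), β (f j).toKIdx.hN (f j).toKIdx.D (f j).toKIdx.hk (ιB j s) = s)
    (hG1 : ∀ u : 𝔸ˣ, u ∈ G → ‖(u : 𝔸)‖ ≤ 1) (hpar : ∀ j (U : CfgY 𝔸 (f j).toKIdx), GVal G (f j).toKIdx U → ∀ z w, par j U z w ∈ G)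
    (hunit : ∀ j (U : CfgY 𝔸 (f j).toKIdx), GVal G (f j).toKIdx U → IsUnit (Node00.deltaPrimeAY (f j).toKIdx (par j) U))
    (dB : ℕ) (M₂ : ℝ) (hM₂ : 0 ≤ M₂) (hrepr : ∀ (v : 𝔸) (j : ι), |b.repr v j| ≤ M₂ * ‖v‖) (hcR : 0 < M₂ * ∑ j, ‖b j‖)
    (Cq : ℝ) (hCq : 0 ≤ Cq) (hC37 : ∀ j β' U a, C37 j β' U a → GVal G (f j).toKIdx U ∧ CplxLettersY G (f j) (par j) (ιB j) Cq β' U a)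
    (MInv aInv aW : ℝ) (hMInv : 0 < MInv) (haInv : 0 < aInv) (haW : 0 < aW) :
    B9SectBGpStepAtLettersV2.GlobFrame₂ c35 (fun j => geo9Y (f j)) (fun j => (codingYx G (f j) (C37 j) (C38 j)).bg)
      (fun j => KSC₃ G (f j) (par j) (C37 j) (C38 j)) b (Fin (d + 1)) (fun j => SiteY (f j).toKIdx) :=
  { B9SectBCodedChainOnSubfamily.gpFrame₂CodedOn f c35 G b C37 C38 par ιB (fun j => KSC₃ G (f j) (par j) (C37 j) (C38 j)) hι hG1 hpar hunit dB M₂ hM₂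
      hrepr Cq hCq hC37 (M₂ * ∑ j, ‖b j‖) hcR (fun B _ => (M₂ * ∑ j, ‖b j‖) * B + 1) (fun B _ hB _ => by positivity) (fun δ => δ) (fun δ hδ => hδ)
      MInv aInv aW hMInv haInv haW (fun j => read342Y_KSC₃ G (f j) (par j) (C37 j) (C38 j) b (ιB j) (hι j) M₂ hM₂ hrepr c35 MInv aInv)
      (fun j => write342Y_KSC₃ G (f j) (par j) (C37 j) (C38 j) b (ιB j) (hι j) M₂ hM₂ hrepr aW fun β' U a h => (hC37 j β' U a h).1) with
    wG := fun _ _ => 1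
    wG_pos := fun _ _ _ _ => one_pos
    writeGlob := fun j c c' α₁ B δ _ _ h37 _ _ _ _ _ _ => by
      obtain ⟨U, a, rfl, rfl, -⟩ := (codingYx G (f j) (C37 j) (C38 j)).exists_of_bg_Cplx337 h37
      exact globBlock_KSC₃_prod G (f j) (par j) (C37 j) (C38 j) U a zero_le_one }

end Frames

end Literature.MathematicalPhysics.QuantumFieldTheory.Balaban1983to89.B9SectBL2DictionaryY

end
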